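import Literature.Analysis.PDE.TorusMoserCommutator
import Literature.Analysis.PDE.TorusMoserCommutatorGen
import Literature.Analysis.PDE.TorusLinearSymmetricHyperbolicSymmetrised
import HarnessLib

/-!
# A-priori energy estimates for the linearised quasilinear symmetric hyperbolic system on `𝕋³`
# and on `𝕋^ι` at a generic Sobolev margin (topic `Analysis/PDE`)

Analysis/PDE support file (everything proved; a `Prop`-valued structure and three auxiliary
definitions with bodies, no named facts) of the energy method for quasilinear symmetric
hyperbolic systems on `𝕋³` (Dafermos 2005, Thm 5.1.1; Majda 1984, Ch. 2, Thm 2.1), towards the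
named fact `Literature.MathematicalPhysics.KineticTheory.hsEuler_localExistence`. The Picard
scheme of that method solves, for a given coefficient field `V`, the LINEAR system

  `A₀(V) ∂ₜU + Σⱼ Aⱼ(V) ∂ⱼU = 0`   (Dafermos (5.1.10); Majda (2.3a))

and needs four estimates on its smooth solutions, all proved here for smooth coefficient maps
`A₀, Aⱼ : W → End(W)` of a finite-dimensional real inner product space `W`, `A₀` symmetric,
uniformly positive (`⟪A₀(v)w, w⟫ ≥ c₀‖w‖²`) and bounded (`‖A₀(v)‖ ≤ Λ₀`), `Aⱼ` symmetric, with a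
smooth congruence `P` to the identity (`Q = Pᵀ`, `Q A₀ P = 1`; packaged as `IsQLSymmCoeff`):

* `IsQLSymmCoeff.twordEnergy_le` (**high-norm bound**, level `m ≥ 6`; Majda (2.8), Lemma 2.1):
  if `twordEnergy m (V t) ≤ E₀` and `‖∂ₜV‖ ≤ D₀` on `[0, T]` then
  `twordEnergy m (U t) ≤ (Λ₀/c₀) e^{C t} twordEnergy m (U 0)`, `C = C(E₀, D₀)`;
* `IsQLSymmCoeff.timeDeriv_sq_le` — `‖∂ₜU(t,x)‖² ≤ C(E₀) twordEnergy m (U t)` (from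
  `∂ₜU = -Σⱼ ãⱼ(V)∂ⱼU`, `ãⱼ = A₀⁻¹Aⱼ = P Q Aⱼ`, and `H² ⊂ L^∞`);
* `IsQLSymmCoeff.diff_sq_integral_le` (**contraction in the low norm**; Majda (2.10)–(2.12),
  Dafermos (5.1.18)–(5.1.23)): for two solutions `U, U'` with coefficient fields `V, V'` and
  the same data, `∫‖U(t) - U'(t)‖² ≤ C (e^{Ct} - 1) sup_{[0,T]} ∫‖V - V'‖²`;
* `IsQLSymmCoeff.step_invariant` (**propagation of higher regularity on a fixed interval**,
  level `m ≥ 8`; Majda, Cor. 1 of Thm 2.2): under level-`(m-1)` bounds on `V, U`, the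
  exponentially weighted bound `twordEnergy m (V t) ≤ B e^{λt}` passes from `V` to `U`, with
  `λ, B` depending only on the level-`(m-1)` bounds and the level-`m` energy of the datum.

Generic Sobolev margin (all space dimensions): each of the four estimates, and the two
auxiliary constants `exists_bulk_le`, `exists_sq_norm_sum_qlATil_le` behind them, is proved first
at a generic margin `σ` under the word-form sup embedding HYPOTHESIS
`hS : Torus.WordSupEmbedding ι σ` (`‖f x‖² ≤ C_s · twordEnergy σ f`; theorems `…_of_wordSup`,
levels `m ≥ σ + 1`, `2σ + 2`, `2σ + 4` in place of `3`, `6`, `8`, commutator bounds from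
`TorusMoserCommutatorGen`), and the `𝕋³` statements above are their `σ = 2` instances through
`wordSupEmbedding_two_of_card_eq_three` (Majda 1984, Ch. 2 §2.1: the energy method in any number
of space variables once `H^σ ⊂ L^∞`, `2σ > n`). With `Torus.wordSupEmbedding_fin4_three` the
`σ = 3` instances are the a-priori estimates of a four-dimensional energy chain.

The mechanism (Dafermos (5.1.13)–(5.1.16)): `∂ₜU = -Σⱼ ãⱼ(V)∂ⱼU`; applying `∂^w` gives
`A₀(V)∂ₜU_w + ΣⱼAⱼ(V)∂ⱼU_w = -A₀(V) Σⱼ [∂^w, ãⱼ(V)]∂ⱼU` (`IsQLSymmCoeff.word_equation`), the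
commutators are bounded in `L²` by `TorusMoserCommutator`, and the summed (optionally
exponentially weighted) `L²` energy identity of `TorusSymmetricHyperbolicEnergy` with Grönwall's
inequality closes the estimate (`symmHypEnergy_sum_le_gronwallBound`,
`IsQLSymmCoeff.weighted_energy_le`).

## Mathlib / tree search

Tree: `hasDerivWithinAt_symmHypEnergy`, `symmHypEnergy_le_gronwallBound`,
`mul_integral_norm_sq_le_symmHypEnergy`, `integral_inner_clm_apply_self_le`
(`TorusSymmetricHyperbolicEnergy`), `exists_tcomm_sq_integral_le(_step)`,
`exists_sup_iterPartialDeriv_comp_le` (`TorusMoserCommutator`), their generic-margin forms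
`…_of_wordSup` and `wordSupEmbedding_two_of_card_eq_three` (`TorusMoserCommutatorGen`),
`norm_sq_iterPartialDeriv_le_twordEnergy_of_margin` (`TorusWordEnergyMargin`),
`Torus.WordSupEmbedding` (`FunctionSpaces/TorusWordSupEmbedding`), `clm_comp_eq_one_comm`
(`TorusLinearSymmetricHyperbolicSymmetrised`), `TorusWordCalculus`. Mathlib:
`le_gronwallBound_of_liminf_deriv_right_le`, `gronwallBound_ε0`, `gronwallBound_of_K_ne_0`,
`Convex.norm_image_sub_le_of_norm_fderiv_le`, `sq_sum_le_card_mul_sum_sq`.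

## References

* A. Majda, *Compressible Fluid Flow and Systems of Conservation Laws in Several Space
  Variables*, Springer 1984, Ch. 2 §2.1, Thm 2.1 (proof: (2.3)–(2.12), Lemma 2.1) and Thm 2.2,
  Cor. 1. [`Majda1984`]
* C. M. Dafermos, *Hyperbolic Conservation Laws in Continuum Physics*, 2nd ed., Springer 2005,
  §5.1, proof of Thm 5.1.1, (5.1.10)–(5.1.23). [`Dafermos2005`]
* K. O. Friedrichs, Comm. Pure Appl. Math. 7 (1954) 345–392, §1. [`Friedrichs1954`]
-/

noncomputable section

open MeasureTheory Set Filter Function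
open scoped ContDiff InnerProductSpace Topology

namespace Literature.Analysis.PDE

open Literature.Analysis.FunctionSpaces Literature.Analysis.FunctionSpaces.Torus

universe u

variable {ι : Type*} [Fintype ι] [DecidableEq ι]
variable {W : Type u} [NormedAddCommGroup W] [InnerProductSpace ℝ W]

/-! ## Small tools -/

section Tools

variable {F' : Type*} [NormedAddCommGroup F'] [NormedSpace ℝ F']

omit [DecidableEq ι] in
/-- Time slices of a field jointly smooth on `ℝ × 𝕋ⁿ` are differentiable in time with
derivative `Torus.timeDeriv`. [folklore] -/
theorem hasDerivAt_slice_of_univ {u : ℝ → UnitAddTorus ι → F'} (hu : IsSmoothSpaceTimeOn univ u)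
    (t : ℝ) (x : UnitAddTorus ι) : HasDerivAt (fun τ => u τ x) (timeDeriv u t x) t := by
  have h := (hu.hasDerivWithinAt_slice (mem_univ t) x).hasDerivAt Filter.univ_mem
  have e : timeDerivWithin univ u t x = timeDeriv u t x :=
    congr_fun (derivWithin_univ (f := fun τ => u τ x)) t
  rwa [e] at h

omit [DecidableEq ι] in
/-- For a field smooth on `ℝ × 𝕋ⁿ` the one-sided time derivative within `[a, b]` is the
two-sided one. [folklore] -/
theorem timeDerivWithin_Icc_eq_timeDeriv {u : ℝ → UnitAddTorus ι → F'}
    (hu : IsSmoothSpaceTimeOn univ u) {a b : ℝ} (hab : a < b) {t : ℝ} (ht : t ∈ Icc a b)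
    (x : UnitAddTorus ι) : timeDerivWithin (Icc a b) u t x = timeDeriv u t x :=
  timeDerivWithin_eq_timeDeriv_of_contDiff (contDiff_stLift_of_isSmoothSpaceTimeOn_univ hu)
    (uniqueDiffOn_Icc hab) ht x

omit [Fintype ι] [DecidableEq ι] in
/-- `2⟪r, u⟫ ≤ ‖r‖² + ‖u‖²`. [folklore] -/
theorem two_inner_le_sq_add_sq (r u : W) : 2 * ⟪r, u⟫_ℝ ≤ ‖r‖ ^ 2 + ‖u‖ ^ 2 := by
  have := real_inner_le_norm r u
  nlinarith [sq_nonneg (‖r‖ - ‖u‖)]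

omit [Fintype ι] [DecidableEq ι] in
/-- The Grönwall bound with a negative rate stays below `δ + ε/|K|`. [folklore] -/
theorem gronwallBound_le_of_neg {δ K ε x : ℝ} (hK : K < 0) (hδ : 0 ≤ δ) (hε : 0 ≤ ε) (hx : 0 ≤ x) :
    gronwallBound δ K ε x ≤ δ + ε / (-K) := by
  rw [gronwallBound_of_K_ne_0 hK.ne]
  have h1 : Real.exp (K * x) ≤ 1 := Real.exp_le_one_iff.2 (mul_nonpos_of_nonpos_of_nonneg hK.le hx)
  have h2 : 0 < Real.exp (K * x) := Real.exp_pos _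
  have h3 : δ * Real.exp (K * x) ≤ δ := mul_le_of_le_one_right hδ h1
  have h4 : ε / K * (Real.exp (K * x) - 1) ≤ ε / (-K) := by
    have hK' : 0 < -K := neg_pos.2 hK
    have e1 : ε / K * (Real.exp (K * x) - 1) = ε / (-K) * (1 - Real.exp (K * x)) := by
      rw [div_neg]; ring
    rw [e1]
    exact mul_le_of_le_one_right (div_nonneg hε hK'.le) (by linarith)
  linarith

end Tools

/-! ## The summed `L²` energy inequality -/

section SumGronwall

/-- **Summed (and damped) form of the `L²` energy estimate** of
`TorusSymmetricHyperbolicEnergy`: for a finite family `(Uᵢ)` of jointly smooth fields on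
`[a, b] × 𝕋ⁿ` with common symmetric coefficients `A₀` (coercive, `c₀`) and `Aⱼ`, the bulk bound
`⟪(∂ₜA₀ + Σ∂ⱼAⱼ)v, v⟫ ≤ K‖v‖²` and the summed residual bound
`Σᵢ 2∫⟪𝓛Uᵢ, Uᵢ⟫ ≤ L Σᵢ∫‖Uᵢ‖² - μ Σᵢ∫⟪A₀Uᵢ, Uᵢ⟫ + ε` (`K, L ≥ 0`, `μ` real), the total energy
`E = Σᵢ ∫⟪A₀Uᵢ, Uᵢ⟫` obeys `E(t) ≤ gronwallBound E(a) ((K+L)/c₀ - μ) ε (t - a)`.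
[cite: Dafermos2005, §5.1 (5.1.13)–(5.1.16), (5.1.22)–(5.1.23)] -/
theorem symmHypEnergy_sum_le_gronwallBound {a b : ℝ} (hab : a < b) {κ : Type*} (s : Finset κ)
    {A₀ : ℝ → UnitAddTorus ι → (W →L[ℝ] W)} {A : ι → ℝ → UnitAddTorus ι → (W →L[ℝ] W)}
    {U : κ → ℝ → UnitAddTorus ι → W} (hA₀ : IsSmoothSpaceTimeOn (Icc a b) A₀)
    (hA : ∀ j, IsSmoothSpaceTimeOn (Icc a b) (A j))
    (hU : ∀ i ∈ s, IsSmoothSpaceTimeOn (Icc a b) (U i))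
    (hsym₀ : ∀ t ∈ Icc a b, ∀ x (v w : W), ⟪A₀ t x v, w⟫_ℝ = ⟪v, A₀ t x w⟫_ℝ)
    (hsym : ∀ j, ∀ t ∈ Icc a b, ∀ x (v w : W), ⟪A j t x v, w⟫_ℝ = ⟪v, A j t x w⟫_ℝ)
    {c₀ K L μ ε : ℝ} (hc₀ : 0 < c₀) (hK : 0 ≤ K) (hL : 0 ≤ L)
    (hcoer : ∀ t ∈ Icc a b, ∀ x (v : W), c₀ * ‖v‖ ^ 2 ≤ ⟪A₀ t x v, v⟫_ℝ)
    (hbulk : ∀ t ∈ Ico a b, ∀ x (v : W),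
      ⟪(timeDerivWithin (Icc a b) A₀ t x + ∑ j, partialDeriv j (A j t) x) v, v⟫_ℝ ≤
        K * ‖v‖ ^ 2)
    (hres : ∀ t ∈ Ico a b,
      ∑ i ∈ s, 2 * ∫ x, ⟪A₀ t x (timeDerivWithin (Icc a b) (U i) t x) +
          ∑ j, A j t x (partialDeriv j (U i t) x), U i t x⟫_ℝ ≤
        L * (∑ i ∈ s, ∫ x, ‖U i t x‖ ^ 2) -
          μ * (∑ i ∈ s, ∫ x, ⟪A₀ t x (U i t x), U i t x⟫_ℝ) + ε) :
    ∀ t ∈ Icc a b, ∑ i ∈ s, ∫ x, ⟪A₀ t x (U i t x), U i t x⟫_ℝ ≤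
      gronwallBound (∑ i ∈ s, ∫ x, ⟪A₀ a x (U i a x), U i a x⟫_ℝ) ((K + L) / c₀ - μ) ε (t - a) := by
  have hS : Convex ℝ (Icc a b) := convex_Icc a b
  have hSu : UniqueDiffOn ℝ (Icc a b) := uniqueDiffOn_Icc hab
  -- energies and their derivatives, per field
  set Ei : κ → ℝ → ℝ := fun i t => ∫ x, ⟪A₀ t x (U i t x), U i t x⟫_ℝ with hEi_def
  set Ei' : κ → ℝ → ℝ := fun i t =>
    (∫ x, ⟪timeDerivWithin (Icc a b) A₀ t x (U i t x), U i t x⟫_ℝ) +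
      (∑ j, ∫ x, ⟪partialDeriv j (A j t) x (U i t x), U i t x⟫_ℝ) +
      2 * ∫ x, ⟪A₀ t x (timeDerivWithin (Icc a b) (U i) t x) +
        ∑ j, A j t x (partialDeriv j (U i t) x), U i t x⟫_ℝ with hEi'_def
  set E : ℝ → ℝ := fun t => ∑ i ∈ s, Ei i t with hE_def
  set E' : ℝ → ℝ := fun t => ∑ i ∈ s, Ei' i t with hE'_def
  have hderiv : ∀ t ∈ Icc a b, HasDerivWithinAt E (E' t) (Icc a b) t := fun t ht =>
    HasDerivWithinAt.fun_sum fun i hi =>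
      hasDerivWithinAt_symmHypEnergy hS hSu hA₀ hA (hU i hi) hsym₀ hsym ht
  have hcont : ContinuousOn E (Icc a b) := fun t ht => (hderiv t ht).continuousWithinAt
  have hderiv' : ∀ t ∈ Ico a b, HasDerivWithinAt E (E' t) (Ici t) t := by
    intro t ht
    refine (hderiv t (Ico_subset_Icc_self ht)).mono_of_mem_nhdsWithin ?_
    exact mem_of_superset (Icc_mem_nhdsGE ht.2) (Icc_subset_Icc ht.1 le_rfl)
  -- the differential inequality
  have hbound : ∀ t ∈ Ico a b, E' t ≤ ((K + L) / c₀ - μ) * E t + ε := by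
    intro t ht
    have ht' : t ∈ Icc a b := Ico_subset_Icc_self ht
    have hAt : ∀ j, IsSmooth (A j t) := fun j => (hA j).isSmooth_slice ht'
    have hA₀t : IsSmooth (A₀ t) := hA₀.isSmooth_slice ht'
    have hdA₀ : IsSmooth (timeDerivWithin (Icc a b) A₀ t) := hA₀.isSmooth_timeDerivWithin hSu ht'
    -- per-field bulk bound and coercivity
    have hper : ∀ i ∈ s,
        (∫ x, ⟪timeDerivWithin (Icc a b) A₀ t x (U i t x), U i t x⟫_ℝ) +
          (∑ j, ∫ x, ⟪partialDeriv j (A j t) x (U i t x), U i t x⟫_ℝ) ≤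
            K * ∫ x, ‖U i t x‖ ^ 2 ∧
        c₀ * (∫ x, ‖U i t x‖ ^ 2) ≤ Ei i t := by
      intro i hi
      have hUt : IsSmooth (U i t) := (hU i hi).isSmooth_slice ht'
      refine ⟨?_, mul_integral_norm_sq_le_symmHypEnergy hA₀t hUt (hcoer t ht')⟩
      have hB : Continuous fun x => timeDerivWithin (Icc a b) A₀ t x + ∑ j, partialDeriv j (A j t) x :=
        hdA₀.continuous.add (continuous_finsetSum _ fun j _ => ((hAt j).partialDeriv j).continuous)
      have hbulkI := integral_inner_clm_apply_self_le hB hUt.continuous (hbulk t ht)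
      have hc0 : Continuous fun x => ⟪timeDerivWithin (Icc a b) A₀ t x (U i t x), U i t x⟫_ℝ :=
        (hdA₀.continuous.clm_apply hUt.continuous).inner hUt.continuous
      have hc2 : ∀ j, Continuous fun x => ⟪partialDeriv j (A j t) x (U i t x), U i t x⟫_ℝ := fun j =>
        (((hAt j).partialDeriv j).continuous.clm_apply hUt.continuous).inner hUt.continuous
      have hsplit : ∫ x, ⟪(timeDerivWithin (Icc a b) A₀ t x + ∑ j, partialDeriv j (A j t) x)
          (U i t x), U i t x⟫_ℝ = (∫ x, ⟪timeDerivWithin (Icc a b) A₀ t x (U i t x), U i t x⟫_ℝ) +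
            ∑ j, ∫ x, ⟪partialDeriv j (A j t) x (U i t x), U i t x⟫_ℝ := by
        have hpt : (fun x => ⟪(timeDerivWithin (Icc a b) A₀ t x + ∑ j, partialDeriv j (A j t) x)
            (U i t x), U i t x⟫_ℝ) = fun x => ⟪timeDerivWithin (Icc a b) A₀ t x (U i t x), U i t x⟫_ℝ +
              ∑ j, ⟪partialDeriv j (A j t) x (U i t x), U i t x⟫_ℝ := by
          funext x
          rw [add_apply, sum_apply, inner_add_left, sum_inner]
        rw [hpt, integral_add hc0.integrable_unitAddTorus
          (continuous_finsetSum _ fun j _ => hc2 j).integrable_unitAddTorus,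
          integral_finsetSum _ fun j _ => (hc2 j).integrable_unitAddTorus]
      rw [← hsplit]
      exact hbulkI
    have h1 : ∑ i ∈ s, ((∫ x, ⟪timeDerivWithin (Icc a b) A₀ t x (U i t x), U i t x⟫_ℝ) +
        (∑ j, ∫ x, ⟪partialDeriv j (A j t) x (U i t x), U i t x⟫_ℝ)) ≤
          K * ∑ i ∈ s, ∫ x, ‖U i t x‖ ^ 2 := by
      rw [Finset.mul_sum]
      exact Finset.sum_le_sum fun i hi => (hper i hi).1
    have h2 : c₀ * ∑ i ∈ s, (∫ x, ‖U i t x‖ ^ 2) ≤ E t := by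
      rw [Finset.mul_sum]
      exact Finset.sum_le_sum fun i hi => (hper i hi).2
    have h3 := hres t ht
    have hN0 : 0 ≤ ∑ i ∈ s, ∫ x, ‖U i t x‖ ^ 2 :=
      Finset.sum_nonneg fun i _ => integral_nonneg fun _ => sq_nonneg _
    have h4 : (K + L) * (∑ i ∈ s, ∫ x, ‖U i t x‖ ^ 2) ≤ (K + L) / c₀ * E t := by
      rw [div_mul_eq_mul_div, le_div_iff₀ hc₀]
      calc (K + L) * (∑ i ∈ s, ∫ x, ‖U i t x‖ ^ 2) * c₀
          = (K + L) * (c₀ * ∑ i ∈ s, ∫ x, ‖U i t x‖ ^ 2) := by ring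
        _ ≤ (K + L) * E t := mul_le_mul_of_nonneg_left h2 (add_nonneg hK hL)
    have hE'eq : E' t = ∑ i ∈ s, ((∫ x, ⟪timeDerivWithin (Icc a b) A₀ t x (U i t x), U i t x⟫_ℝ) +
        (∑ j, ∫ x, ⟪partialDeriv j (A j t) x (U i t x), U i t x⟫_ℝ)) +
        ∑ i ∈ s, 2 * ∫ x, ⟪A₀ t x (timeDerivWithin (Icc a b) (U i) t x) +
          ∑ j, A j t x (partialDeriv j (U i t) x), U i t x⟫_ℝ := by
      simp only [hE'_def, hEi'_def, ← Finset.sum_add_distrib]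
    rw [hE'eq]
    have hEt : E t = ∑ i ∈ s, ∫ x, ⟪A₀ t x (U i t x), U i t x⟫_ℝ := rfl
    rw [hEt] at h4 ⊢
    nlinarith
  intro t ht
  exact le_gronwallBound_of_liminf_deriv_right_le hcont
    (fun s' hs' r hr => (hderiv' s' hs').liminf_right_slope_le hr) le_rfl hbound t ht

end SumGronwall

/-! ## Quasilinear symmetric coefficient structures -/

section Coeff

variable [FiniteDimensional ℝ W]

/-- **Symmetrised quasilinear coefficient data** on a finite-dimensional real inner product
space: smooth `A₀, Aⱼ, P, Q : W → End(W)` with `A₀(v)` symmetric, `c₀`-coercive and bounded by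
`Λ₀`, `Aⱼ(v)` symmetric, `Q(v) = P(v)ᵀ` and `Q(v) A₀(v) P(v) = 1` (a smooth congruence of `A₀`
to the identity; e.g. `P = Q = diag(aᵢ^{-1/2})` for diagonal `A₀`). The (cut-off) coefficients
of a quasilinear symmetric hyperbolic system `A₀(U)∂ₜU + ΣⱼAⱼ(U)∂ⱼU = 0`.
[cite: Majda1984, Ch. 2 §2.1, (2.1)–(2.2); Dafermos2005, §5.1 (5.1.5)–(5.1.7)] -/
structure IsQLSymmCoeff (c₀ Λ₀ : ℝ) (a0 : W → (W →L[ℝ] W)) (a : ι → W → (W →L[ℝ] W))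
    (p q : W → (W →L[ℝ] W)) : Prop where
  smooth₀ : ContDiff ℝ ∞ a0
  smooth : ∀ j, ContDiff ℝ ∞ (a j)
  smooth_p : ContDiff ℝ ∞ p
  smooth_q : ContDiff ℝ ∞ q
  symm₀ : ∀ v (w w' : W), ⟪a0 v w, w'⟫_ℝ = ⟪w, a0 v w'⟫_ℝ
  symm : ∀ j v (w w' : W), ⟪a j v w, w'⟫_ℝ = ⟪w, a j v w'⟫_ℝ
  pos : 0 < c₀
  coer : ∀ v (w : W), c₀ * ‖w‖ ^ 2 ≤ ⟪a0 v w, w⟫_ℝ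
  norm_le : ∀ v, ‖a0 v‖ ≤ Λ₀
  adj : ∀ v (w w' : W), ⟪p v w, w'⟫_ℝ = ⟪w, q v w'⟫_ℝ
  inv : ∀ v (w : W), q v (a0 v (p v w)) = w

/-- **`ãⱼ(v) = A₀(v)⁻¹ Aⱼ(v) = P(v) Q(v) Aⱼ(v)`**, the coefficients of the system solved for
`∂ₜU`. [cite: Majda1984, Ch. 2 §2.1, proof of Thm 2.1] -/
def qlATil (a : ι → W → (W →L[ℝ] W)) (p q : W → (W →L[ℝ] W)) (j : ι) (v : W) : W →L[ℝ] W :=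
  ((p v).comp (q v)).comp (a j v)

omit [Fintype ι] [DecidableEq ι] [FiniteDimensional ℝ W] in
/-- Unfolding. [folklore] -/
@[simp]
theorem qlATil_apply (a : ι → W → (W →L[ℝ] W)) (p q : W → (W →L[ℝ] W)) (j : ι) (v w : W) :
    qlATil a p q j v w = p v (q v (a j v w)) := rfl

namespace IsQLSymmCoeff

variable {c₀ Λ₀ : ℝ} {a0 : W → (W →L[ℝ] W)} {a : ι → W → (W →L[ℝ] W)} {p q : W → (W →L[ℝ] W)}

omit [Fintype ι] [DecidableEq ι] in
/-- `P Q A₀ = 1`. [folklore] -/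
theorem pqa (h : IsQLSymmCoeff c₀ Λ₀ a0 a p q) (v w : W) : p v (q v (a0 v w)) = w :=
  clm_comp_eq_one_comm (P := p v) (L := (q v).comp (a0 v)) (h.inv v) w

omit [Fintype ι] [DecidableEq ι] in
/-- `A₀ P Q = 1`. [folklore] -/
theorem apq (h : IsQLSymmCoeff c₀ Λ₀ a0 a p q) (v w : W) : a0 v (p v (q v w)) = w := by
  have h1 := clm_comp_eq_one_comm (P := (a0 v).comp (p v)) (L := q v) (h.inv v) w
  simpa using h1

omit [Fintype ι] [DecidableEq ι] in
/-- `A₀ ãⱼ = Aⱼ`. [folklore] -/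
theorem a0_qlATil (h : IsQLSymmCoeff c₀ Λ₀ a0 a p q) (j : ι) (v w : W) :
    a0 v (qlATil a p q j v w) = a j v w := by
  rw [qlATil_apply, h.apq]

omit [Fintype ι] [DecidableEq ι] [FiniteDimensional ℝ W] in
/-- `ãⱼ` is smooth. [folklore] -/
theorem contDiff_qlATil (h : IsQLSymmCoeff c₀ Λ₀ a0 a p q) (j : ι) : ContDiff ℝ ∞ (qlATil a p q j) :=
  (h.smooth_p.clm_comp h.smooth_q).clm_comp (h.smooth j)

omit [Fintype ι] [DecidableEq ι] [FiniteDimensional ℝ W] in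
/-- `0 ≤ Λ₀`. [folklore] -/
theorem Λ₀_nonneg (h : IsQLSymmCoeff c₀ Λ₀ a0 a p q) : 0 ≤ Λ₀ := (norm_nonneg _).trans (h.norm_le 0)

omit [Fintype ι] [DecidableEq ι] [FiniteDimensional ℝ W] in
/-- `⟪A₀(v) w, w⟫ ≤ Λ₀ ‖w‖²`. [folklore] -/
theorem inner_le (h : IsQLSymmCoeff c₀ Λ₀ a0 a p q) (v w : W) : ⟪a0 v w, w⟫_ℝ ≤ Λ₀ * ‖w‖ ^ 2 :=
  calc ⟪a0 v w, w⟫_ℝ ≤ ‖a0 v w‖ * ‖w‖ := real_inner_le_norm _ _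
    _ ≤ Λ₀ * ‖w‖ * ‖w‖ := mul_le_mul_of_nonneg_right
        ((ContinuousLinearMap.le_opNorm _ _).trans (mul_le_mul_of_nonneg_right (h.norm_le v) (norm_nonneg _)))
        (norm_nonneg _)
    _ = Λ₀ * ‖w‖ ^ 2 := by ring

omit [Fintype ι] [DecidableEq ι] [FiniteDimensional ℝ W] in
/-- **Time reversal**: `(A₀, -Aⱼ, P, Q)` is again admissible. [folklore] -/
theorem neg (h : IsQLSymmCoeff c₀ Λ₀ a0 a p q) : IsQLSymmCoeff c₀ Λ₀ a0 (fun j v => -a j v) p q where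
  smooth₀ := h.smooth₀
  smooth j := (h.smooth j).neg
  smooth_p := h.smooth_p
  smooth_q := h.smooth_q
  symm₀ := h.symm₀
  symm j v w w' := by simp [inner_neg_left, inner_neg_right, h.symm j v w w']
  pos := h.pos
  coer := h.coer
  norm_le := h.norm_le
  adj := h.adj
  inv := h.inv

/-! ### Solutions of the linearised system: `∂ₜU` and the word equations -/

variable {V U : ℝ → UnitAddTorus ι → W}

/-- **`∂ₜU = -Σⱼ ãⱼ(V) ∂ⱼU`** for a solution of `A₀(V)∂ₜU + ΣⱼAⱼ(V)∂ⱼU = 0`.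
[cite: Majda1984, Ch. 2 §2.1, proof of Thm 2.1] -/
theorem timeDeriv_eq (h : IsQLSymmCoeff c₀ Λ₀ a0 a p q)
    (hEq : ∀ t x, a0 (V t x) (timeDeriv U t x) + ∑ j, a j (V t x) (partialDeriv j (U t) x) = 0)
    (t : ℝ) (x : UnitAddTorus ι) :
    timeDeriv U t x = -∑ j, qlATil a p q j (V t x) (partialDeriv j (U t) x) := by
  have h1 := congrArg (fun w => p (V t x) (q (V t x) w)) (hEq t x)
  simp only [map_add, map_sum, map_zero, h.pqa] at h1
  rw [eq_neg_iff_add_eq_zero]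
  simpa only [qlATil_apply] using h1

/-- **The differentiated equations** (Dafermos (5.1.13); Majda (2.3)–(2.5)): for a solution of
`A₀(V)∂ₜU + ΣⱼAⱼ(V)∂ⱼU = 0` on `ℝ × 𝕋ⁿ` and a word `w`, the field `U_w = ∂^w U` satisfies
`A₀(V)∂ₜU_w + ΣⱼAⱼ(V)∂ⱼU_w = -A₀(V) Σⱼ [∂^w, ãⱼ(V)] ∂ⱼU`.
[cite: Dafermos2005, §5.1 (5.1.13); Majda1984, Ch. 2 §2.1 (2.3)–(2.5)] -/
theorem word_equation (h : IsQLSymmCoeff c₀ Λ₀ a0 a p q) (hV : IsSmoothSpaceTimeOn univ V)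
    (hU : IsSmoothSpaceTimeOn univ U)
    (hEq : ∀ t x, a0 (V t x) (timeDeriv U t x) + ∑ j, a j (V t x) (partialDeriv j (U t) x) = 0)
    (w : List ι) (t : ℝ) (x : UnitAddTorus ι) :
    a0 (V t x) (timeDeriv (fun s y => iterPartialDeriv w (U s) y) t x) +
        ∑ j, a j (V t x) (partialDeriv j (iterPartialDeriv w (U t)) x) =
      -(a0 (V t x) (∑ j, tcomm (qlATil a p q j) (V t) w (partialDeriv j (U t)) x)) := by
  have hUt : IsSmooth (U t) := hU.isSmooth_slice (mem_univ t)
  have hVt : IsSmooth (V t) := hV.isSmooth_slice (mem_univ t)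
  have hG : ∀ j, IsSmooth fun y => qlATil a p q j (V t y) (partialDeriv j (U t) y) := fun j =>
    isSmooth_clm_apply (isSmooth_comp (h.contDiff_qlATil j) hVt) (hUt.partialDeriv j)
  rw [timeDeriv_iterPartialDeriv_comm hU w t x]
  have hsum : IsSmooth fun y => ∑ j, qlATil a p q j (V t y) (partialDeriv j (U t) y) := by
    show ContDiff ℝ ∞ fun z => ∑ j, qlATil a p q j (V t (proj z)) (partialDeriv j (U t) (proj z))
    exact ContDiff.sum fun j _ => hG j
  have hslice : timeDeriv U t = fun y => (-1 : ℝ) • ∑ j, qlATil a p q j (V t y) (partialDeriv j (U t) y) := by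
    funext y
    rw [h.timeDeriv_eq hEq t y, neg_one_smul]
  rw [hslice, iterPartialDeriv_const_smul hsum (-1) w]
  simp only
  rw [iterPartialDeriv_finset_sum Finset.univ (fun j _ => hG j) w]
  have hterm : ∀ j, iterPartialDeriv w (fun y => qlATil a p q j (V t y) (partialDeriv j (U t) y)) x =
      qlATil a p q j (V t x) (partialDeriv j (iterPartialDeriv w (U t)) x) +
        tcomm (qlATil a p q j) (V t) w (partialDeriv j (U t)) x := by
    intro j
    rw [tcomm_apply]
    have e : iterPartialDeriv w (partialDeriv j (U t)) x = partialDeriv j (iterPartialDeriv w (U t)) x := by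
      rw [← iterPartialDeriv_cons_eq hUt j w, iterPartialDeriv_cons]
    rw [e]
    abel
  simp only [hterm, Finset.sum_add_distrib, smul_add, map_add, map_sum, neg_one_smul,
    h.a0_qlATil, map_neg]
  abel

/-! ### Constants: bulk term, residuals, `∂ₜU` -/

/-- **The bulk constant at a generic Sobolev margin `σ`**: under a word-form sup embedding
`hS : WordSupEmbedding ι σ`, `twordEnergy m (V t) ≤ E₀` (`m ≥ σ + 1`) and `‖∂ₜV‖ ≤ D₀` on
`[0, T]`, `⟪(∂ₜA₀(V) + Σⱼ∂ⱼAⱼ(V)) v, v⟫ ≤ K(E₀, D₀) ‖v‖²`. The `𝕋³` case `σ = 2` is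
`exists_bulk_le`. [cite: Majda1984, Ch. 2 §2.1, proof of Thm 2.1, (2.8)] -/
theorem exists_bulk_le_of_wordSup {σ : ℕ} (hS : WordSupEmbedding.{u, _} ι σ)
    (h : IsQLSymmCoeff c₀ Λ₀ a0 a p q) {m : ℕ} (hm : σ + 1 ≤ m) (E₀ D₀ : ℝ) :
    ∃ K : ℝ, 0 ≤ K ∧ ∀ (V : ℝ → UnitAddTorus ι → W) (T : ℝ), IsSmoothSpaceTimeOn univ V →
      (∀ t ∈ Icc 0 T, twordEnergy m (V t) ≤ E₀) → (∀ t ∈ Icc 0 T, ∀ x, ‖timeDeriv V t x‖ ≤ D₀) →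
      ∀ t ∈ Icc 0 T, ∀ x (v : W),
        ⟪(timeDeriv (fun s y => a0 (V s y)) t x + ∑ j, partialDeriv j (fun y => a j (V t y)) x) v,
          v⟫_ℝ ≤ K * ‖v‖ ^ 2 := by
  obtain ⟨Cd, hCd0, hCd⟩ := exists_sup_iterPartialDeriv_comp_le_of_wordSup hS (G := fderiv ℝ a0)
    (h.smooth₀.fderiv_right (m := ∞) (by norm_cast)) m E₀
  choose Ca hCa0 hCa using fun j : ι =>
    exists_sup_iterPartialDeriv_comp_le_of_wordSup hS (h.smooth j) m E₀
  have hCa' : 0 ≤ ∑ j, Ca j := Finset.sum_nonneg fun j _ => hCa0 j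
  refine ⟨Cd * |D₀| + ∑ j, Ca j, by positivity, fun V T hV hVE hVd t ht x v => ?_⟩
  have hVt : IsSmooth (V t) := hV.isSmooth_slice (mem_univ t)
  have hdt : timeDeriv (fun s y => a0 (V s y)) t x = fderiv ℝ a0 (V t x) (timeDeriv V t x) := by
    have h1 : HasDerivAt (fun s => a0 (V s x)) (fderiv ℝ a0 (V t x) (timeDeriv V t x)) t :=
      (h.smooth₀.differentiable (by simp)).differentiableAt.hasFDerivAt.comp_hasDerivAt t
        (hasDerivAt_slice_of_univ hV t x)
    exact h1.deriv
  have hn1 : ‖timeDeriv (fun s y => a0 (V s y)) t x‖ ≤ Cd * |D₀| := by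
    rw [hdt]
    refine (ContinuousLinearMap.le_opNorm _ _).trans
      (mul_le_mul ?_ ((hVd t ht x).trans (le_abs_self _)) (norm_nonneg _) hCd0)
    have := hCd (V t) hVt (hVE t ht) [] (by simp; omega) x
    simpa using this
  have hn2 : ∀ j, ‖partialDeriv j (fun y => a j (V t y)) x‖ ≤ Ca j := fun j => by
    have := hCa j (V t) hVt (hVE t ht) [j] (by simp; omega) x
    simpa using this
  have hn : ‖timeDeriv (fun s y => a0 (V s y)) t x + ∑ j, partialDeriv j (fun y => a j (V t y)) x‖ ≤
      Cd * |D₀| + ∑ j, Ca j :=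
    (norm_add_le _ _).trans (add_le_add hn1 ((norm_sum_le _ _).trans (Finset.sum_le_sum fun j _ => hn2 j)))
  calc ⟪(timeDeriv (fun s y => a0 (V s y)) t x + ∑ j, partialDeriv j (fun y => a j (V t y)) x) v, v⟫_ℝ
      ≤ ‖(timeDeriv (fun s y => a0 (V s y)) t x + ∑ j, partialDeriv j (fun y => a j (V t y)) x) v‖ * ‖v‖ :=
        real_inner_le_norm _ _
    _ ≤ (Cd * |D₀| + ∑ j, Ca j) * ‖v‖ * ‖v‖ :=
        mul_le_mul_of_nonneg_right ((ContinuousLinearMap.le_opNorm _ _).trans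
          (mul_le_mul_of_nonneg_right hn (norm_nonneg _))) (norm_nonneg _)
    _ = (Cd * |D₀| + ∑ j, Ca j) * ‖v‖ ^ 2 := by ring

/-- **The bulk constant**: under `twordEnergy m (V t) ≤ E₀` (`m ≥ 3`) and `‖∂ₜV‖ ≤ D₀` on
`[0, T]`, `⟪(∂ₜA₀(V) + Σⱼ∂ⱼAⱼ(V)) v, v⟫ ≤ K(E₀, D₀) ‖v‖²`.
[cite: Majda1984, Ch. 2 §2.1, proof of Thm 2.1, (2.8)] -/
theorem exists_bulk_le (hd : Fintype.card ι = 3) (h : IsQLSymmCoeff c₀ Λ₀ a0 a p q) {m : ℕ}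
    (hm : 3 ≤ m) (E₀ D₀ : ℝ) :
    ∃ K : ℝ, 0 ≤ K ∧ ∀ (V : ℝ → UnitAddTorus ι → W) (T : ℝ), IsSmoothSpaceTimeOn univ V →
      (∀ t ∈ Icc 0 T, twordEnergy m (V t) ≤ E₀) → (∀ t ∈ Icc 0 T, ∀ x, ‖timeDeriv V t x‖ ≤ D₀) →
      ∀ t ∈ Icc 0 T, ∀ x (v : W),
        ⟪(timeDeriv (fun s y => a0 (V s y)) t x + ∑ j, partialDeriv j (fun y => a j (V t y)) x) v,
          v⟫_ℝ ≤ K * ‖v‖ ^ 2 :=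
  h.exists_bulk_le_of_wordSup (wordSupEmbedding_two_of_card_eq_three hd) (by omega) E₀ D₀

omit [DecidableEq ι] [FiniteDimensional ℝ W] in
/-- **The residual of a word equation in `L²`**: `∫‖A₀(V)(Σⱼ cⱼ)‖² ≤ Λ₀² n Σⱼ ∫‖cⱼ‖²` for
continuous `cⱼ` (`n = card ι`). [folklore] -/
theorem residual_sq_integral_le (h : IsQLSymmCoeff c₀ Λ₀ a0 a p q) {Vs : UnitAddTorus ι → W}
    {c : ι → UnitAddTorus ι → W} (hVs : Continuous Vs) (hc : ∀ j, Continuous (c j)) :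
    ∫ x, ‖a0 (Vs x) (∑ j, c j x)‖ ^ 2 ≤ Λ₀ ^ 2 * Fintype.card ι * ∑ j, ∫ x, ‖c j x‖ ^ 2 := by
  have hpt : ∀ x, ‖a0 (Vs x) (∑ j, c j x)‖ ^ 2 ≤ Λ₀ ^ 2 * Fintype.card ι * ∑ j, ‖c j x‖ ^ 2 := by
    intro x
    have h1 : ‖a0 (Vs x) (∑ j, c j x)‖ ≤ Λ₀ * ∑ j, ‖c j x‖ :=
      (ContinuousLinearMap.le_opNorm _ _).trans
        (mul_le_mul (h.norm_le _) (norm_sum_le _ _) (norm_nonneg _) h.Λ₀_nonneg)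
    have h2 : (∑ j, ‖c j x‖) ^ 2 ≤ Fintype.card ι * ∑ j, ‖c j x‖ ^ 2 := by
      have := sq_sum_le_card_mul_sum_sq (s := (Finset.univ : Finset ι)) (f := fun j => ‖c j x‖)
      simpa using this
    have h3 : 0 ≤ ∑ j, ‖c j x‖ := Finset.sum_nonneg fun j _ => norm_nonneg _
    calc ‖a0 (Vs x) (∑ j, c j x)‖ ^ 2 ≤ (Λ₀ * ∑ j, ‖c j x‖) ^ 2 :=
          pow_le_pow_left₀ (norm_nonneg _) h1 2
      _ = Λ₀ ^ 2 * (∑ j, ‖c j x‖) ^ 2 := by ring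
      _ ≤ Λ₀ ^ 2 * (Fintype.card ι * ∑ j, ‖c j x‖ ^ 2) :=
          mul_le_mul_of_nonneg_left h2 (sq_nonneg _)
      _ = _ := by ring
  have hcont : Continuous fun x => ‖a0 (Vs x) (∑ j, c j x)‖ ^ 2 :=
    (((h.smooth₀.continuous.comp hVs).clm_apply (continuous_finsetSum _ fun j _ => hc j)).norm.pow 2)
  have hcont' : ∀ j, Continuous fun x => ‖c j x‖ ^ 2 := fun j => (hc j).norm.pow 2
  calc ∫ x, ‖a0 (Vs x) (∑ j, c j x)‖ ^ 2 ≤ ∫ x, Λ₀ ^ 2 * Fintype.card ι * ∑ j, ‖c j x‖ ^ 2 :=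
        integral_mono hcont.integrable_unitAddTorus
          ((continuous_const.mul (continuous_finsetSum _ fun j _ => hcont' j)).integrable_unitAddTorus) hpt
    _ = Λ₀ ^ 2 * Fintype.card ι * ∑ j, ∫ x, ‖c j x‖ ^ 2 := by
        rw [integral_const_mul, integral_finsetSum _ fun j _ => (hcont' j).integrable_unitAddTorus]

/-- **`‖Σⱼ ãⱼ(V)∂ⱼU‖² ≤ C(E₀) · twordEnergy m U`** pointwise, at a generic Sobolev margin `σ`
(`m ≥ σ + 1`, `hS : WordSupEmbedding ι σ` in place of `H² ⊂ L^∞` on `𝕋³`). The `𝕋³` case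
`σ = 2` is `exists_sq_norm_sum_qlATil_le`.
[cite: Majda1984, Ch. 2 §2.1, proof of Thm 2.1, (2.9b)] -/
theorem exists_sq_norm_sum_qlATil_le_of_wordSup {σ : ℕ} (hS : WordSupEmbedding.{u, _} ι σ)
    (h : IsQLSymmCoeff c₀ Λ₀ a0 a p q) {m : ℕ} (hm : σ + 1 ≤ m) (E₀ : ℝ) :
    ∃ C : ℝ, 0 ≤ C ∧ ∀ Vs Us : UnitAddTorus ι → W, IsSmooth Vs → IsSmooth Us →
      twordEnergy m Vs ≤ E₀ → ∀ x,
        ‖∑ j, qlATil a p q j (Vs x) (partialDeriv j Us x)‖ ^ 2 ≤ C * twordEnergy m Us := by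
  obtain ⟨Cs, hCs0, hCs⟩ := hS W
  choose Ca hCa0 hCa using fun j : ι =>
    exists_sup_iterPartialDeriv_comp_le_of_wordSup hS (h.contDiff_qlATil j) m E₀
  have hCa' : 0 ≤ ∑ j, Ca j := Finset.sum_nonneg fun j _ => hCa0 j
  refine ⟨(∑ j, Ca j) ^ 2 * Cs, by positivity, fun Vs Us hVs hUs hVE x => ?_⟩
  set EU := twordEnergy m Us with hEU
  have hEU0 : 0 ≤ EU := twordEnergy_nonneg m Us
  have h1 : ∀ j, ‖qlATil a p q j (Vs x) (partialDeriv j Us x)‖ ≤ Ca j * √(Cs * EU) := by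
    intro j
    refine (ContinuousLinearMap.le_opNorm _ _).trans (mul_le_mul ?_ ?_ (norm_nonneg _) (hCa0 j))
    · have := hCa j Vs hVs hVE [] (by simp; omega) x
      simpa using this
    · rw [← Real.sqrt_sq (norm_nonneg _)]
      refine Real.sqrt_le_sqrt ?_
      have := norm_sq_iterPartialDeriv_le_twordEnergy_of_margin hCs hCs0.le hUs (c := [j])
        (m := m) (by simp; omega) x
      simpa using this
  have h2 : ‖∑ j, qlATil a p q j (Vs x) (partialDeriv j Us x)‖ ≤ (∑ j, Ca j) * √(Cs * EU) := by
    refine (norm_sum_le _ _).trans ?_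
    rw [Finset.sum_mul]
    exact Finset.sum_le_sum fun j _ => h1 j
  calc ‖∑ j, qlATil a p q j (Vs x) (partialDeriv j Us x)‖ ^ 2 ≤ ((∑ j, Ca j) * √(Cs * EU)) ^ 2 :=
        pow_le_pow_left₀ (norm_nonneg _) h2 2
    _ = (∑ j, Ca j) ^ 2 * Cs * EU := by
        rw [mul_pow, Real.sq_sqrt (mul_nonneg hCs0.le hEU0)]; ring

/-- **`‖Σⱼ ãⱼ(V)∂ⱼU‖² ≤ C(E₀) · twordEnergy m U`** pointwise (`m ≥ 3`, `H² ⊂ L^∞` on `𝕋³`);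
with `∂ₜU = -Σⱼãⱼ(V)∂ⱼU` this is the sup bound on `∂ₜU` of the scheme.
[cite: Majda1984, Ch. 2 §2.1, proof of Thm 2.1, (2.9b)] -/
theorem exists_sq_norm_sum_qlATil_le (hd : Fintype.card ι = 3) (h : IsQLSymmCoeff c₀ Λ₀ a0 a p q)
    {m : ℕ} (hm : 3 ≤ m) (E₀ : ℝ) :
    ∃ C : ℝ, 0 ≤ C ∧ ∀ Vs Us : UnitAddTorus ι → W, IsSmooth Vs → IsSmooth Us →
      twordEnergy m Vs ≤ E₀ → ∀ x,
        ‖∑ j, qlATil a p q j (Vs x) (partialDeriv j Us x)‖ ^ 2 ≤ C * twordEnergy m Us :=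
  h.exists_sq_norm_sum_qlATil_le_of_wordSup (wordSupEmbedding_two_of_card_eq_three hd) (by omega) E₀

/-! ### The weighted energy inequality for solutions -/

omit [Fintype ι] [DecidableEq ι] [FiniteDimensional ℝ W] in
/-- Pointwise algebra of the exponential weight: with `c' = -(λ/2) e`,
`2⟪e r + c' A u, e u⟫ ≤ e²‖r‖² + ‖e u‖² - λ ⟪A (e u), e u⟫`. [folklore] -/
theorem weight_pointwise (A : W →L[ℝ] W) (r u : W) (e lam : ℝ) :
    2 * ⟪e • r + (e * (-(lam * 1) / 2)) • A u, e • u⟫_ℝ ≤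
      (e ^ 2 * ‖r‖ ^ 2 + ‖e • u‖ ^ 2) - lam * ⟪A (e • u), e • u⟫_ℝ := by
  have h1 := mul_le_mul_of_nonneg_left (two_inner_le_sq_add_sq r u) (sq_nonneg e)
  simp only [inner_add_left, real_inner_smul_left, real_inner_smul_right, map_smul, norm_smul,
    Real.norm_eq_abs, mul_pow, sq_abs]
  nlinarith [h1]

/-- **The weighted summed energy inequality for a solution of the linearised system**
(Dafermos (5.1.13)–(5.1.16) at level `m`, with an exponential weight `e^{-λt}`): if on `[0, T]`
the bulk term is bounded by `K` and the summed squared residuals by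
`L₁ · twordEnergy m (U t) + f t` with `e^{-λt} f t ≤ ε`, then
`e^{-λt} Σ_{|w|≤m} ∫⟪A₀(V)U_w, U_w⟫ (t) ≤ gronwallBound (Σ ∫⟪A₀(V)U_w, U_w⟫(0)) ((K+L₁+1)/c₀ - λ) ε t`.
[cite: Dafermos2005, §5.1 (5.1.13)–(5.1.16); Majda1984, Ch. 2 §2.1, Lemma 2.1] -/
theorem weighted_energy_le (h : IsQLSymmCoeff c₀ Λ₀ a0 a p q) (hV : IsSmoothSpaceTimeOn univ V)
    (hU : IsSmoothSpaceTimeOn univ U) {T : ℝ} (hT : 0 < T)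
    (hEq : ∀ t x, a0 (V t x) (timeDeriv U t x) + ∑ j, a j (V t x) (partialDeriv j (U t) x) = 0)
    (m : ℕ) {K L₁ lam ε : ℝ} (hK : 0 ≤ K) (hL₁ : 0 ≤ L₁) {f : ℝ → ℝ}
    (hbulk : ∀ t ∈ Icc 0 T, ∀ x (v : W),
      ⟪(timeDeriv (fun s y => a0 (V s y)) t x + ∑ j, partialDeriv j (fun y => a j (V t y)) x) v,
        v⟫_ℝ ≤ K * ‖v‖ ^ 2)
    (hR : ∀ t ∈ Icc 0 T, ∑ w ∈ wordsLE ι m,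
      ∫ x, ‖a0 (V t x) (∑ j, tcomm (qlATil a p q j) (V t) w (partialDeriv j (U t)) x)‖ ^ 2 ≤
        L₁ * twordEnergy m (U t) + f t)
    (hf : ∀ t ∈ Icc 0 T, Real.exp (-(lam * t)) * f t ≤ ε) :
    ∀ t ∈ Icc 0 T, Real.exp (-(lam * t)) * ∑ w ∈ wordsLE ι m,
        ∫ x, ⟪a0 (V t x) (iterPartialDeriv w (U t) x), iterPartialDeriv w (U t) x⟫_ℝ ≤
      gronwallBound (∑ w ∈ wordsLE ι m,
        ∫ x, ⟪a0 (V 0 x) (iterPartialDeriv w (U 0) x), iterPartialDeriv w (U 0) x⟫_ℝ)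
        ((K + (L₁ + 1)) / c₀ - lam) ε t := by
  -- the weight and the weighted family
  have he : ∀ s, HasDerivAt (fun τ => Real.exp (-(lam * τ) / 2))
      (Real.exp (-(lam * s) / 2) * (-(lam * 1) / 2)) s :=
    fun s => (((hasDerivAt_id s).const_mul lam).neg.div_const 2).exp
  have hθ' : ContDiff ℝ ∞ (stLift fun (τ : ℝ) (_ : UnitAddTorus ι) => Real.exp (-(lam * τ) / 2)) := by
    show ContDiff ℝ ∞ fun z : ℝ × EuclideanSpace ℝ ι => Real.exp (-(lam * z.1) / 2)
    exact Real.contDiff_exp.comp ((contDiff_const.mul contDiff_fst).neg.div_const 2)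
  have hθ : IsSmoothSpaceTimeOn univ fun (τ : ℝ) (_ : UnitAddTorus ι) => Real.exp (-(lam * τ) / 2) :=
    isSmoothSpaceTimeOn_of_contDiff hθ' univ
  have hUw : ∀ w : List ι, IsSmoothSpaceTimeOn univ fun s y => iterPartialDeriv w (U s) y := fun w =>
    isSmoothSpaceTimeOn_iterPartialDeriv hU uniqueDiffOn_univ w
  have hUt : ∀ w : List ι, IsSmoothSpaceTimeOn univ fun s y =>
      Real.exp (-(lam * s) / 2) • iterPartialDeriv w (U s) y := fun w => hθ.smul (hUw w)
  have hA₀ : IsSmoothSpaceTimeOn univ fun s y => a0 (V s y) := isSmoothSpaceTimeOn_comp h.smooth₀ hV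
  have hA : ∀ j, IsSmoothSpaceTimeOn univ fun s y => a j (V s y) := fun j =>
    isSmoothSpaceTimeOn_comp (h.smooth j) hV
  -- bulk hypothesis in the one-sided form
  have hbulk' : ∀ t ∈ Ico 0 T, ∀ x (v : W),
      ⟪(timeDerivWithin (Icc 0 T) (fun s y => a0 (V s y)) t x +
        ∑ j, partialDeriv j ((fun j s y => a j (V s y)) j t) x) v, v⟫_ℝ ≤ K * ‖v‖ ^ 2 := by
    intro t ht x v
    have ht' : t ∈ Icc 0 T := Ico_subset_Icc_self ht
    rw [timeDerivWithin_Icc_eq_timeDeriv hA₀ hT ht']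
    exact hbulk t ht' x v
  -- the residual hypothesis
  have hres' : ∀ t ∈ Ico 0 T,
      ∑ w ∈ wordsLE ι m, 2 * ∫ x, ⟪a0 (V t x) (timeDerivWithin (Icc 0 T)
          (fun s y => Real.exp (-(lam * s) / 2) • iterPartialDeriv w (U s) y) t x) +
          ∑ j, a j (V t x) (partialDeriv j
            ((fun s y => Real.exp (-(lam * s) / 2) • iterPartialDeriv w (U s) y) t) x),
          Real.exp (-(lam * t) / 2) • iterPartialDeriv w (U t) x⟫_ℝ ≤
        (L₁ + 1) * (∑ w ∈ wordsLE ι m, ∫ x, ‖Real.exp (-(lam * t) / 2) • iterPartialDeriv w (U t) x‖ ^ 2) -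
          lam * (∑ w ∈ wordsLE ι m, ∫ x, ⟪a0 (V t x) (Real.exp (-(lam * t) / 2) • iterPartialDeriv w (U t) x),
            Real.exp (-(lam * t) / 2) • iterPartialDeriv w (U t) x⟫_ℝ) + ε := by
    intro t ht
    rw [← Finset.mul_sum]
    have ht' : t ∈ Icc 0 T := Ico_subset_Icc_self ht
    set e : ℝ := Real.exp (-(lam * t) / 2) with he_def
    have he2 : e ^ 2 = Real.exp (-(lam * t)) := by
      rw [he_def, sq, ← Real.exp_add]; ring_nf
    have hUts : ∀ w : List ι, IsSmooth (U t) := fun _ => hU.isSmooth_slice (mem_univ t)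
    have hUs : IsSmooth (U t) := hU.isSmooth_slice (mem_univ t)
    have hVs : IsSmooth (V t) := hV.isSmooth_slice (mem_univ t)
    -- the operator applied to the weighted word fields
    have hL : ∀ w : List ι, ∀ x,
        a0 (V t x) (timeDerivWithin (Icc 0 T)
            (fun s y => Real.exp (-(lam * s) / 2) • iterPartialDeriv w (U s) y) t x) +
          ∑ j, a j (V t x) (partialDeriv j
            ((fun s y => Real.exp (-(lam * s) / 2) • iterPartialDeriv w (U s) y) t) x) =
        e • (-(a0 (V t x) (∑ j, tcomm (qlATil a p q j) (V t) w (partialDeriv j (U t)) x))) +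
          (e * (-(lam * 1) / 2)) • a0 (V t x) (iterPartialDeriv w (U t) x) := by
      intro w x
      rw [timeDerivWithin_Icc_eq_timeDeriv (hUt w) hT ht']
      have hd1 : timeDeriv (fun s y => Real.exp (-(lam * s) / 2) • iterPartialDeriv w (U s) y) t x =
          e • timeDeriv (fun s y => iterPartialDeriv w (U s) y) t x +
            (e * (-(lam * 1) / 2)) • iterPartialDeriv w (U t) x :=
        ((he t).smul (hasDerivAt_slice_of_univ (hUw w) t x)).deriv
      have hd2 : ∀ j, partialDeriv j
          ((fun s y => Real.exp (-(lam * s) / 2) • iterPartialDeriv w (U s) y) t) x =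
            e • partialDeriv j (iterPartialDeriv w (U t)) x := by
        intro j
        have h1 : IsContDiff 1 (iterPartialDeriv w (U t)) := (hUs.iterPartialDeriv w).isContDiff (by simp)
        have h2 := partialDeriv_const_smul h1 e j
        show partialDeriv j (e • iterPartialDeriv w (U t)) x = e • partialDeriv j (iterPartialDeriv w (U t)) x
        rw [h2]
        rfl
      rw [hd1]
      simp only [hd2, map_add, map_smul, Finset.smul_sum, ← h.word_equation hV hU hEq w t x, smul_add]
      abel
    -- per word pointwise and integrated bound
    have hword : ∀ w ∈ wordsLE ι m,
        2 * ∫ x, ⟪a0 (V t x) (timeDerivWithin (Icc 0 T)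
            (fun s y => Real.exp (-(lam * s) / 2) • iterPartialDeriv w (U s) y) t x) +
            ∑ j, a j (V t x) (partialDeriv j
              ((fun s y => Real.exp (-(lam * s) / 2) • iterPartialDeriv w (U s) y) t) x),
            e • iterPartialDeriv w (U t) x⟫_ℝ ≤
          e ^ 2 * (∫ x, ‖a0 (V t x) (∑ j, tcomm (qlATil a p q j) (V t) w (partialDeriv j (U t)) x)‖ ^ 2) +
            (∫ x, ‖e • iterPartialDeriv w (U t) x‖ ^ 2) -
            lam * ∫ x, ⟪a0 (V t x) (e • iterPartialDeriv w (U t) x), e • iterPartialDeriv w (U t) x⟫_ℝ := by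
      intro w _
      simp only [hL]
      -- continuity of the pieces
      have hcR : Continuous fun x => -(a0 (V t x) (∑ j, tcomm (qlATil a p q j) (V t) w (partialDeriv j (U t)) x)) :=
        ((isSmooth_comp h.smooth₀ hVs).continuous.clm_apply
          (continuous_finsetSum _ fun j _ => (isSmooth_tcomm (h.contDiff_qlATil j) hVs w (hUs.partialDeriv j)).continuous)).neg
      have hcu : Continuous fun x => iterPartialDeriv w (U t) x := (hUs.iterPartialDeriv w).continuous
      have hcA : Continuous fun x => a0 (V t x) := (isSmooth_comp h.smooth₀ hVs).continuous
      have hpt := fun x => weight_pointwise (a0 (V t x))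
        (-(a0 (V t x) (∑ j, tcomm (qlATil a p q j) (V t) w (partialDeriv j (U t)) x)))
        (iterPartialDeriv w (U t) x) e lam
      have hi1 : Integrable (fun x => 2 * ⟪e • -(a0 (V t x) (∑ j, tcomm (qlATil a p q j) (V t) w (partialDeriv j (U t)) x)) +
          (e * (-(lam * 1) / 2)) • a0 (V t x) (iterPartialDeriv w (U t) x), e • iterPartialDeriv w (U t) x⟫_ℝ) volume :=
        (continuous_const.mul (((hcR.const_smul e).add ((hcA.clm_apply hcu).const_smul _)).inner
          (hcu.const_smul e))).integrable_unitAddTorus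
      have hc2 : Continuous fun x => e ^ 2 * ‖-(a0 (V t x) (∑ j, tcomm (qlATil a p q j) (V t) w (partialDeriv j (U t)) x))‖ ^ 2 :=
        continuous_const.mul (hcR.norm.pow 2)
      have hc3 : Continuous fun x => ‖e • iterPartialDeriv w (U t) x‖ ^ 2 := (hcu.const_smul e).norm.pow 2
      have hc4 : Continuous fun x => lam * ⟪a0 (V t x) (e • iterPartialDeriv w (U t) x), e • iterPartialDeriv w (U t) x⟫_ℝ :=
        continuous_const.mul ((hcA.clm_apply (hcu.const_smul e)).inner (hcu.const_smul e))
      have hi3 : Integrable (fun x => e ^ 2 * ‖-(a0 (V t x) (∑ j, tcomm (qlATil a p q j) (V t) w (partialDeriv j (U t)) x))‖ ^ 2 +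
          ‖e • iterPartialDeriv w (U t) x‖ ^ 2) volume := (hc2.add hc3).integrable_unitAddTorus
      have hi4 : Integrable (fun x => lam * ⟪a0 (V t x) (e • iterPartialDeriv w (U t) x), e • iterPartialDeriv w (U t) x⟫_ℝ) volume :=
        hc4.integrable_unitAddTorus
      have hi2 : Integrable (fun x => (e ^ 2 * ‖-(a0 (V t x) (∑ j, tcomm (qlATil a p q j) (V t) w (partialDeriv j (U t)) x))‖ ^ 2 +
          ‖e • iterPartialDeriv w (U t) x‖ ^ 2) -
          lam * ⟪a0 (V t x) (e • iterPartialDeriv w (U t) x), e • iterPartialDeriv w (U t) x⟫_ℝ) volume :=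
        hi3.sub hi4
      have hi5 : Integrable (fun x => e ^ 2 * ‖-(a0 (V t x) (∑ j, tcomm (qlATil a p q j) (V t) w (partialDeriv j (U t)) x))‖ ^ 2) volume :=
        hc2.integrable_unitAddTorus
      have hi6 : Integrable (fun x => ‖e • iterPartialDeriv w (U t) x‖ ^ 2) volume := hc3.integrable_unitAddTorus
      rw [← integral_const_mul]
      refine (integral_mono hi1 hi2 hpt).trans (le_of_eq ?_)
      rw [integral_sub hi3 hi4, integral_add hi5 hi6, integral_const_mul, integral_const_mul]
      simp only [norm_neg]
    -- sum over the words
    have hsum := Finset.sum_le_sum hword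
    simp only [Finset.sum_sub_distrib, Finset.sum_add_distrib, ← Finset.mul_sum] at hsum
    refine hsum.trans ?_
    -- the residual term
    have hR' := hR t ht'
    have hf' := hf t ht'
    have hEU : e ^ 2 * twordEnergy m (U t) =
        ∑ w ∈ wordsLE ι m, ∫ x, ‖e • iterPartialDeriv w (U t) x‖ ^ 2 := by
      rw [twordEnergy_def, Finset.mul_sum]
      refine Finset.sum_congr rfl fun w _ => ?_
      rw [← integral_const_mul]
      refine integral_congr_ae (Eventually.of_forall fun x => ?_)
      simp only [norm_smul, mul_pow, Real.norm_eq_abs, sq_abs]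
    have he20 : 0 ≤ e ^ 2 := sq_nonneg e
    have h1 : e ^ 2 * ∑ w ∈ wordsLE ι m,
        ∫ x, ‖a0 (V t x) (∑ j, tcomm (qlATil a p q j) (V t) w (partialDeriv j (U t)) x)‖ ^ 2 ≤
          L₁ * (∑ w ∈ wordsLE ι m, ∫ x, ‖e • iterPartialDeriv w (U t) x‖ ^ 2) + ε := by
      calc _ ≤ e ^ 2 * (L₁ * twordEnergy m (U t) + f t) := mul_le_mul_of_nonneg_left hR' he20
        _ = L₁ * (e ^ 2 * twordEnergy m (U t)) + Real.exp (-(lam * t)) * f t := by rw [he2]; ring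
        _ ≤ _ := by rw [hEU]; exact add_le_add le_rfl hf'
    nlinarith [h1]
  -- apply the summed energy inequality
  have main := symmHypEnergy_sum_le_gronwallBound (ι := ι) (W := W) hT (wordsLE ι m)
    (A₀ := fun s y => a0 (V s y)) (A := fun j s y => a j (V s y))
    (U := fun w s y => Real.exp (-(lam * s) / 2) • iterPartialDeriv w (U s) y)
    (hA₀.mono (subset_univ _)) (fun j => (hA j).mono (subset_univ _))
    (fun w _ => (hUt w).mono (subset_univ _))
    (fun t _ x v w' => h.symm₀ (V t x) v w') (fun j t _ x v w' => h.symm j (V t x) v w')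
    h.pos hK (by positivity : (0 : ℝ) ≤ L₁ + 1)
    (fun t _ x v => h.coer (V t x) v) hbulk' hres'
  intro t ht
  have h1 := main t ht
  simp only [mul_zero, neg_zero, zero_div, Real.exp_zero, one_smul, sub_zero] at h1
  -- identify the weighted energy
  have hE : ∑ w ∈ wordsLE ι m, ∫ x, ⟪a0 (V t x) (Real.exp (-(lam * t) / 2) • iterPartialDeriv w (U t) x),
      Real.exp (-(lam * t) / 2) • iterPartialDeriv w (U t) x⟫_ℝ =
      Real.exp (-(lam * t)) * ∑ w ∈ wordsLE ι m,
        ∫ x, ⟪a0 (V t x) (iterPartialDeriv w (U t) x), iterPartialDeriv w (U t) x⟫_ℝ := by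
    rw [Finset.mul_sum]
    refine Finset.sum_congr rfl fun w _ => ?_
    rw [← integral_const_mul]
    refine integral_congr_ae (Eventually.of_forall fun x => ?_)
    simp only [map_smul, real_inner_smul_left, real_inner_smul_right]
    rw [← mul_assoc, ← Real.exp_add]
    ring_nf
  rw [hE] at h1
  convert h1 using 2

/-! ### The high-norm bound at the base level -/

omit [FiniteDimensional ℝ W] in
/-- Lower bound of the `A₀`-energy by the word energy: `c₀ · twordEnergy m f ≤ Σ∫⟪A₀f_w, f_w⟫`.
[folklore] -/
theorem mul_twordEnergy_le (h : IsQLSymmCoeff c₀ Λ₀ a0 a p q) {Vs fs : UnitAddTorus ι → W}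
    (hVs : IsSmooth Vs) (hfs : IsSmooth fs) (m : ℕ) :
    c₀ * twordEnergy m fs ≤ ∑ w ∈ wordsLE ι m,
      ∫ x, ⟪a0 (Vs x) (iterPartialDeriv w fs x), iterPartialDeriv w fs x⟫_ℝ := by
  rw [twordEnergy_def, Finset.mul_sum]
  exact Finset.sum_le_sum fun w _ => mul_integral_norm_sq_le_symmHypEnergy
    (isSmooth_comp h.smooth₀ hVs) (hfs.iterPartialDeriv w) fun x v => h.coer (Vs x) v

omit [FiniteDimensional ℝ W] in
/-- Upper bound of the `A₀`-energy: `Σ∫⟪A₀f_w, f_w⟫ ≤ Λ₀ · twordEnergy m f`. [folklore] -/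
theorem a0Energy_le (h : IsQLSymmCoeff c₀ Λ₀ a0 a p q) {Vs fs : UnitAddTorus ι → W}
    (hVs : IsSmooth Vs) (hfs : IsSmooth fs) (m : ℕ) :
    ∑ w ∈ wordsLE ι m, ∫ x, ⟪a0 (Vs x) (iterPartialDeriv w fs x), iterPartialDeriv w fs x⟫_ℝ ≤
      Λ₀ * twordEnergy m fs := by
  rw [twordEnergy_def, Finset.mul_sum]
  exact Finset.sum_le_sum fun w _ => integral_inner_clm_apply_self_le
    (isSmooth_comp h.smooth₀ hVs).continuous (hfs.iterPartialDeriv w).continuous fun x v => h.inner_le (Vs x) v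

/-- **The high-norm a-priori bound for the linearised system at a generic Sobolev margin `σ`**
(Majda 1984, proof of Thm 2.1, (2.8) via Lemma 2.1): under a word-form sup embedding
`hS : WordSupEmbedding ι σ` on `𝕋^ι`, at a level `m ≥ 2σ + 2`, for bounds `E₀, D₀` there is
`C ≥ 0` such that every smooth solution `U` of `A₀(V)∂ₜU + ΣⱼAⱼ(V)∂ⱼU = 0` whose smooth
coefficient field satisfies `twordEnergy m (V t) ≤ E₀`, `‖∂ₜV(t, x)‖ ≤ D₀` on `[0, T]` obeys
`twordEnergy m (U t) ≤ (Λ₀/c₀) e^{Ct} twordEnergy m (U 0)` for `t ∈ [0, T]`. The `𝕋³` case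
`σ = 2`, `m ≥ 6` is `twordEnergy_le`.
[cite: Majda1984, Ch. 2 §2.1, Thm 2.1 (2.8), Lemma 2.1; Dafermos2005, §5.1 (5.1.16)] -/
theorem twordEnergy_le_of_wordSup {σ : ℕ} (hS : WordSupEmbedding.{u, _} ι σ)
    (h : IsQLSymmCoeff c₀ Λ₀ a0 a p q) {m : ℕ} (hm : 2 * σ + 2 ≤ m) (E₀ D₀ : ℝ) :
    ∃ C : ℝ, 0 ≤ C ∧ ∀ (V U : ℝ → UnitAddTorus ι → W) (T : ℝ), 0 < T →
      IsSmoothSpaceTimeOn univ V → IsSmoothSpaceTimeOn univ U →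
      (∀ t ∈ Icc 0 T, twordEnergy m (V t) ≤ E₀) → (∀ t ∈ Icc 0 T, ∀ x, ‖timeDeriv V t x‖ ≤ D₀) →
      (∀ t x, a0 (V t x) (timeDeriv U t x) + ∑ j, a j (V t x) (partialDeriv j (U t) x) = 0) →
      ∀ t ∈ Icc 0 T, twordEnergy m (U t) ≤ Λ₀ / c₀ * Real.exp (C * t) * twordEnergy m (U 0) := by
  obtain ⟨K, hK0, hK⟩ := h.exists_bulk_le_of_wordSup hS (by omega : σ + 1 ≤ m) E₀ D₀
  choose Ct hCt0 hCt using fun j : ι =>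
    exists_tcomm_sq_integral_le_of_wordSup hS (h.contDiff_qlATil j) hm E₀
  have hCt' : 0 ≤ ∑ j, Ct j := Finset.sum_nonneg fun j _ => hCt0 j
  set L₁ : ℝ := (wordsLE ι m).card * (Λ₀ ^ 2 * Fintype.card ι * ∑ j, Ct j) with hL₁
  have hL₁0 : 0 ≤ L₁ := by positivity
  have hc₀ := h.pos
  refine ⟨(K + (L₁ + 1)) / c₀, by positivity, fun V U T hT hV hU hVE hVd hEq t ht => ?_⟩
  have hR : ∀ s ∈ Icc 0 T, ∑ w ∈ wordsLE ι m,
      ∫ x, ‖a0 (V s x) (∑ j, tcomm (qlATil a p q j) (V s) w (partialDeriv j (U s)) x)‖ ^ 2 ≤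
        L₁ * twordEnergy m (U s) + (fun _ => (0 : ℝ)) s := by
    intro s hs
    have hVs : IsSmooth (V s) := hV.isSmooth_slice (mem_univ s)
    have hUs : IsSmooth (U s) := hU.isSmooth_slice (mem_univ s)
    have hw : ∀ w ∈ wordsLE ι m,
        ∫ x, ‖a0 (V s x) (∑ j, tcomm (qlATil a p q j) (V s) w (partialDeriv j (U s)) x)‖ ^ 2 ≤
          Λ₀ ^ 2 * Fintype.card ι * ∑ j, Ct j * twordEnergy m (U s) := by
      intro w hw'
      refine (h.residual_sq_integral_le hVs.continuous fun j =>
        (isSmooth_tcomm (h.contDiff_qlATil j) hVs w (hUs.partialDeriv j)).continuous).trans ?_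
      refine mul_le_mul_of_nonneg_left (Finset.sum_le_sum fun j _ => ?_) (by positivity)
      exact hCt j (V s) (U s) hVs hUs (hVE s hs) w hw' j
    refine (Finset.sum_le_sum hw).trans (le_of_eq ?_)
    simp only [Finset.sum_const, nsmul_eq_mul, ← Finset.sum_mul, add_zero, hL₁]
    ring
  have core := h.weighted_energy_le hV hU hT hEq m hK0 hL₁0 (lam := 0) (ε := 0)
    (f := fun _ => 0) (hK V T hV hVE hVd) hR (fun s _ => by simp) t ht
  simp only [zero_mul, neg_zero, Real.exp_zero, one_mul, sub_zero, gronwallBound_ε0] at core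
  have hV0 : IsSmooth (V 0) := hV.isSmooth_slice (mem_univ 0)
  have hU0 : IsSmooth (U 0) := hU.isSmooth_slice (mem_univ 0)
  have hVt : IsSmooth (V t) := hV.isSmooth_slice (mem_univ t)
  have hUt : IsSmooth (U t) := hU.isSmooth_slice (mem_univ t)
  have hlow := h.mul_twordEnergy_le hVt hUt m
  have hup := h.a0Energy_le hV0 hU0 m
  have hexp : 0 < Real.exp ((K + (L₁ + 1)) / c₀ * t) := Real.exp_pos _
  rw [div_mul_eq_mul_div, div_mul_eq_mul_div, le_div_iff₀ hc₀]
  calc twordEnergy m (U t) * c₀ = c₀ * twordEnergy m (U t) := mul_comm _ _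
    _ ≤ _ := hlow
    _ ≤ _ := core
    _ ≤ Λ₀ * twordEnergy m (U 0) * Real.exp ((K + (L₁ + 1)) / c₀ * t) :=
        mul_le_mul_of_nonneg_right hup hexp.le
    _ = Λ₀ * Real.exp ((K + (L₁ + 1)) / c₀ * t) * twordEnergy m (U 0) := by ring

/-- **The high-norm a-priori bound for the linearised system** (Majda 1984, proof of Thm 2.1,
(2.8) via Lemma 2.1; Dafermos (5.1.13)–(5.1.16)): on `𝕋³`, at a level `m ≥ 6`, for bounds
`E₀, D₀` there is `C ≥ 0` such that every smooth solution `U` of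
`A₀(V)∂ₜU + ΣⱼAⱼ(V)∂ⱼU = 0` on `ℝ × 𝕋³` whose smooth coefficient field satisfies
`twordEnergy m (V t) ≤ E₀`, `‖∂ₜV(t, x)‖ ≤ D₀` on `[0, T]` obeys
`twordEnergy m (U t) ≤ (Λ₀/c₀) e^{Ct} twordEnergy m (U 0)` for `t ∈ [0, T]`.
[cite: Majda1984, Ch. 2 §2.1, Thm 2.1 (2.8), Lemma 2.1; Dafermos2005, §5.1 (5.1.16)] -/
theorem twordEnergy_le (hd : Fintype.card ι = 3) (h : IsQLSymmCoeff c₀ Λ₀ a0 a p q) {m : ℕ}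
    (hm : 6 ≤ m) (E₀ D₀ : ℝ) :
    ∃ C : ℝ, 0 ≤ C ∧ ∀ (V U : ℝ → UnitAddTorus ι → W) (T : ℝ), 0 < T →
      IsSmoothSpaceTimeOn univ V → IsSmoothSpaceTimeOn univ U →
      (∀ t ∈ Icc 0 T, twordEnergy m (V t) ≤ E₀) → (∀ t ∈ Icc 0 T, ∀ x, ‖timeDeriv V t x‖ ≤ D₀) →
      (∀ t x, a0 (V t x) (timeDeriv U t x) + ∑ j, a j (V t x) (partialDeriv j (U t) x) = 0) →
      ∀ t ∈ Icc 0 T, twordEnergy m (U t) ≤ Λ₀ / c₀ * Real.exp (C * t) * twordEnergy m (U 0) :=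
  h.twordEnergy_le_of_wordSup (wordSupEmbedding_two_of_card_eq_three hd) (by omega) E₀ D₀

/-- **Sup bound on `∂ₜU`** for a solution, at a generic Sobolev margin `σ`:
`‖∂ₜU(t, x)‖² ≤ C(E₀) · twordEnergy m (U t)` once `twordEnergy m (V t) ≤ E₀` (`m ≥ σ + 1`,
`hS : WordSupEmbedding ι σ`). The `𝕋³` case `σ = 2` is `timeDeriv_sq_le`.
[cite: Majda1984, Ch. 2 §2.1, proof of Thm 2.1, (2.9b)] -/
theorem timeDeriv_sq_le_of_wordSup {σ : ℕ} (hS : WordSupEmbedding.{u, _} ι σ)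
    (h : IsQLSymmCoeff c₀ Λ₀ a0 a p q) {m : ℕ} (hm : σ + 1 ≤ m) (E₀ : ℝ) :
    ∃ C : ℝ, 0 ≤ C ∧ ∀ (V U : ℝ → UnitAddTorus ι → W), IsSmoothSpaceTimeOn univ V →
      IsSmoothSpaceTimeOn univ U →
      (∀ t x, a0 (V t x) (timeDeriv U t x) + ∑ j, a j (V t x) (partialDeriv j (U t) x) = 0) →
      ∀ t, twordEnergy m (V t) ≤ E₀ → ∀ x, ‖timeDeriv U t x‖ ^ 2 ≤ C * twordEnergy m (U t) := by
  obtain ⟨C, hC0, hC⟩ := h.exists_sq_norm_sum_qlATil_le_of_wordSup hS hm E₀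
  refine ⟨C, hC0, fun V U hV hU hEq t hVE x => ?_⟩
  rw [h.timeDeriv_eq hEq t x, norm_neg]
  exact hC (V t) (U t) (hV.isSmooth_slice (mem_univ t)) (hU.isSmooth_slice (mem_univ t)) hVE x

/-- **Sup bound on `∂ₜU`** for a solution: `‖∂ₜU(t, x)‖² ≤ C(E₀) · twordEnergy m (U t)` once
`twordEnergy m (V t) ≤ E₀` (`m ≥ 3`). [cite: Majda1984, Ch. 2 §2.1, proof of Thm 2.1, (2.9b)] -/
theorem timeDeriv_sq_le (hd : Fintype.card ι = 3) (h : IsQLSymmCoeff c₀ Λ₀ a0 a p q) {m : ℕ}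
    (hm : 3 ≤ m) (E₀ : ℝ) :
    ∃ C : ℝ, 0 ≤ C ∧ ∀ (V U : ℝ → UnitAddTorus ι → W), IsSmoothSpaceTimeOn univ V →
      IsSmoothSpaceTimeOn univ U →
      (∀ t x, a0 (V t x) (timeDeriv U t x) + ∑ j, a j (V t x) (partialDeriv j (U t) x) = 0) →
      ∀ t, twordEnergy m (V t) ≤ E₀ → ∀ x, ‖timeDeriv U t x‖ ^ 2 ≤ C * twordEnergy m (U t) :=
  h.timeDeriv_sq_le_of_wordSup (wordSupEmbedding_two_of_card_eq_three hd) (by omega) E₀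

/-! ### Contraction in the low norm -/

/-- **The `L²` difference estimate at a generic Sobolev margin `σ`** (Majda 1984, proof of
Thm 2.1, (2.10)–(2.12); Dafermos (5.1.18)–(5.1.23)): under a word-form sup embedding
`hS : WordSupEmbedding ι σ` on `𝕋^ι`, at a level `m ≥ σ + 1`, for bounds `E₀, D₀` there is
`C ≥ 0` with the following property. Let `U, U'` be smooth solutions of the linearised systems
with smooth coefficient fields `V, V'` and the same datum, and assume on `[0, T]` the bounds
`twordEnergy m (V t), twordEnergy m (V' t), twordEnergy m (U' t) ≤ E₀`, `‖∂ₜV‖ ≤ D₀` and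
`∫‖V(t) - V'(t)‖² ≤ δ`. Then `∫‖U(t) - U'(t)‖² ≤ C (e^{Ct} - 1) δ` on `[0, T]`. The `𝕋³` case
`σ = 2` is `diff_sq_integral_le`.
[cite: Majda1984, Ch. 2 §2.1, Thm 2.1 (2.10)–(2.12); Dafermos2005, §5.1 (5.1.18)–(5.1.23)] -/
theorem diff_sq_integral_le_of_wordSup {σ : ℕ} (hS : WordSupEmbedding.{u, _} ι σ)
    (h : IsQLSymmCoeff c₀ Λ₀ a0 a p q) {m : ℕ} (hm : σ + 1 ≤ m) (E₀ D₀ : ℝ) :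
    ∃ C : ℝ, 0 ≤ C ∧ ∀ (V V' U U' : ℝ → UnitAddTorus ι → W) (T δ : ℝ), 0 < T →
      IsSmoothSpaceTimeOn univ V → IsSmoothSpaceTimeOn univ V' →
      IsSmoothSpaceTimeOn univ U → IsSmoothSpaceTimeOn univ U' →
      (∀ t ∈ Icc 0 T, twordEnergy m (V t) ≤ E₀) → (∀ t ∈ Icc 0 T, twordEnergy m (V' t) ≤ E₀) →
      (∀ t ∈ Icc 0 T, twordEnergy m (U' t) ≤ E₀) →
      (∀ t ∈ Icc 0 T, ∀ x, ‖timeDeriv V t x‖ ≤ D₀) →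
      (∀ t x, a0 (V t x) (timeDeriv U t x) + ∑ j, a j (V t x) (partialDeriv j (U t) x) = 0) →
      (∀ t x, a0 (V' t x) (timeDeriv U' t x) + ∑ j, a j (V' t x) (partialDeriv j (U' t) x) = 0) →
      U 0 = U' 0 → (∀ t ∈ Icc 0 T, ∫ x, ‖V t x - V' t x‖ ^ 2 ≤ δ) →
      ∀ t ∈ Icc 0 T, ∫ x, ‖U t x - U' t x‖ ^ 2 ≤ C * (Real.exp (C * t) - 1) * δ := by
  obtain ⟨Cs, hCs0, hCs⟩ := hS W
  obtain ⟨K, hK0, hK⟩ := h.exists_bulk_le_of_wordSup hS hm E₀ D₀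
  obtain ⟨Ct, hCt0, hCt⟩ := h.timeDeriv_sq_le_of_wordSup hS hm E₀
  -- Lipschitz constants of the coefficients on the ball containing the values of `V, V'`
  set ρ : ℝ := √(Cs * E₀) with hρ
  have hball : IsCompact (Metric.closedBall (0 : W) ρ) := isCompact_closedBall 0 ρ
  obtain ⟨La0, hLa0⟩ := hball.exists_bound_of_continuousOn
    ((h.smooth₀.continuous_fderiv (by simp)).continuousOn)
  choose La hLa using fun j : ι => hball.exists_bound_of_continuousOn
    (((h.smooth j).continuous_fderiv (by simp)).continuousOn)
  set La0' : ℝ := max La0 0 with hLa0'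
  set La' : ι → ℝ := fun j => max (La j) 0 with hLa'
  set CR : ℝ := La0' * √(Ct * E₀) + ∑ j, La' j * ρ with hCR
  have hCR0 : 0 ≤ CR := by positivity
  have hc₀ := h.pos
  set K' : ℝ := (K + 1) / c₀ with hK'
  have hK'0 : 0 < K' := by positivity
  refine ⟨max K' (CR ^ 2 / (K' * c₀)), le_max_of_le_left hK'0.le, ?_⟩
  intro V V' U U' T δ hT hV hV' hU hU' hVE hV'E hU'E hVd hEq hEq' h0 hδ t ht
  have hδ0 : 0 ≤ δ := (integral_nonneg fun _ => sq_nonneg _).trans (hδ 0 ⟨le_rfl, hT.le⟩)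
  -- values of `V, V'` lie in the ball
  have hval : ∀ {X : ℝ → UnitAddTorus ι → W}, IsSmoothSpaceTimeOn univ X →
      (∀ s ∈ Icc 0 T, twordEnergy m (X s) ≤ E₀) → ∀ s ∈ Icc 0 T, ∀ x, X s x ∈ Metric.closedBall (0 : W) ρ := by
    intro X hX hXE s hs x
    rw [Metric.mem_closedBall, dist_zero_right, ← Real.sqrt_sq (norm_nonneg _)]
    refine Real.sqrt_le_sqrt ?_
    have := norm_sq_iterPartialDeriv_le_twordEnergy_of_margin hCs hCs0.le
      (hX.isSmooth_slice (mem_univ s)) (c := []) (m := m) (by simp; omega) x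
    exact (by simpa using this : ‖X s x‖ ^ 2 ≤ Cs * twordEnergy m (X s)).trans
      (mul_le_mul_of_nonneg_left (hXE s hs) hCs0.le)
  have hLip0 : ∀ s ∈ Icc 0 T, ∀ x, ‖a0 (V s x) - a0 (V' s x)‖ ≤ La0' * ‖V s x - V' s x‖ :=
    fun s hs x => (convex_closedBall (0 : W) ρ).norm_image_sub_le_of_norm_fderiv_le
      (fun v _ => (h.smooth₀.differentiable (by simp)).differentiableAt)
      (fun v hv => (hLa0 v hv).trans (le_max_left _ _)) (hval hV' hV'E s hs x) (hval hV hVE s hs x)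
  have hLip : ∀ j, ∀ s ∈ Icc 0 T, ∀ x, ‖a j (V s x) - a j (V' s x)‖ ≤ La' j * ‖V s x - V' s x‖ :=
    fun j s hs x => (convex_closedBall (0 : W) ρ).norm_image_sub_le_of_norm_fderiv_le
      (fun v _ => ((h.smooth j).differentiable (by simp)).differentiableAt)
      (fun v hv => (hLa j v hv).trans (le_max_left _ _)) (hval hV' hV'E s hs x) (hval hV hVE s hs x)
  -- the difference and its equation
  have hD : IsSmoothSpaceTimeOn univ fun s y => U s y - U' s y := hU.sub hU'
  have hA₀ : IsSmoothSpaceTimeOn univ fun s y => a0 (V s y) := isSmoothSpaceTimeOn_comp h.smooth₀ hV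
  have hA : ∀ j, IsSmoothSpaceTimeOn univ fun s y => a j (V s y) := fun j =>
    isSmoothSpaceTimeOn_comp (h.smooth j) hV
  have hDeq : ∀ s x, a0 (V s x) (timeDeriv (fun s y => U s y - U' s y) s x) +
      ∑ j, a j (V s x) (partialDeriv j ((fun s y => U s y - U' s y) s) x) =
      -((a0 (V s x) - a0 (V' s x)) (timeDeriv U' s x) +
        ∑ j, (a j (V s x) - a j (V' s x)) (partialDeriv j (U' s) x)) := by
    intro s x
    have hdt : timeDeriv (fun s y => U s y - U' s y) s x = timeDeriv U s x - timeDeriv U' s x :=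
      ((hasDerivAt_slice_of_univ hU s x).sub (hasDerivAt_slice_of_univ hU' s x)).deriv
    have hdj : ∀ j, partialDeriv j ((fun s y => U s y - U' s y) s) x =
        partialDeriv j (U s) x - partialDeriv j (U' s) x := by
      intro j
      have h1 : IsContDiff 1 (U s) := (hU.isSmooth_slice (mem_univ s)).isContDiff (by simp)
      have h2 : IsContDiff 1 (U' s) := (hU'.isSmooth_slice (mem_univ s)).isContDiff (by simp)
      have e1 : ((fun s y => U s y - U' s y) s) = U s + (-1 : ℝ) • U' s := by
        funext y; simp [sub_eq_add_neg]
      rw [e1, partialDeriv_add h1 (h2.smul (-1)) j, Pi.add_apply,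
        partialDeriv_const_smul h2 (-1) j]
      simp [sub_eq_add_neg]
    have e := hEq s x
    have e' := hEq' s x
    rw [hdt]
    simp only [hdj, map_sub, FunLike.coe_sub, Pi.sub_apply, Finset.sum_sub_distrib]
    rw [← sub_eq_zero]
    have : a0 (V s x) (timeDeriv U s x) - a0 (V s x) (timeDeriv U' s x) +
        (∑ j, a j (V s x) (partialDeriv j (U s) x) - ∑ j, a j (V s x) (partialDeriv j (U' s) x)) -
        -((a0 (V s x) (timeDeriv U' s x) - a0 (V' s x) (timeDeriv U' s x)) +
          (∑ j, a j (V s x) (partialDeriv j (U' s) x) - ∑ j, a j (V' s x) (partialDeriv j (U' s) x))) =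
        (a0 (V s x) (timeDeriv U s x) + ∑ j, a j (V s x) (partialDeriv j (U s) x)) -
          (a0 (V' s x) (timeDeriv U' s x) + ∑ j, a j (V' s x) (partialDeriv j (U' s) x)) := by abel
    rw [this, e, e', sub_zero]
  -- pointwise residual bound
  have hRpt : ∀ s ∈ Icc 0 T, ∀ x, ‖(a0 (V s x) - a0 (V' s x)) (timeDeriv U' s x) +
      ∑ j, (a j (V s x) - a j (V' s x)) (partialDeriv j (U' s) x)‖ ≤ CR * ‖V s x - V' s x‖ := by
    intro s hs x
    have hU's : IsSmooth (U' s) := hU'.isSmooth_slice (mem_univ s)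
    have ht1 : ‖timeDeriv U' s x‖ ≤ √(Ct * E₀) := by
      rw [← Real.sqrt_sq (norm_nonneg _)]
      exact Real.sqrt_le_sqrt ((hCt V' U' hV' hU' hEq' s (hV'E s hs) x).trans
        (mul_le_mul_of_nonneg_left (hU'E s hs) hCt0))
    have ht2 : ∀ j, ‖partialDeriv j (U' s) x‖ ≤ ρ := fun j => by
      rw [hρ, ← Real.sqrt_sq (norm_nonneg _)]
      refine Real.sqrt_le_sqrt ?_
      have := norm_sq_iterPartialDeriv_le_twordEnergy_of_margin hCs hCs0.le hU's (c := [j])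
        (m := m) (by simp; omega) x
      exact (by simpa using this : ‖partialDeriv j (U' s) x‖ ^ 2 ≤ Cs * twordEnergy m (U' s)).trans
        (mul_le_mul_of_nonneg_left (hU'E s hs) hCs0.le)
    calc _ ≤ ‖(a0 (V s x) - a0 (V' s x)) (timeDeriv U' s x)‖ +
          ∑ j, ‖(a j (V s x) - a j (V' s x)) (partialDeriv j (U' s) x)‖ :=
          (norm_add_le _ _).trans (add_le_add le_rfl (norm_sum_le _ _))
      _ ≤ La0' * ‖V s x - V' s x‖ * √(Ct * E₀) + ∑ j, La' j * ‖V s x - V' s x‖ * ρ := by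
          refine add_le_add ?_ (Finset.sum_le_sum fun j _ => ?_)
          · exact (ContinuousLinearMap.le_opNorm _ _).trans
              (mul_le_mul (hLip0 s hs x) ht1 (norm_nonneg _) (by positivity))
          · exact (ContinuousLinearMap.le_opNorm _ _).trans
              (mul_le_mul (hLip j s hs x) (ht2 j) (norm_nonneg _) (by positivity))
      _ = CR * ‖V s x - V' s x‖ := by
          rw [hCR, add_mul, Finset.sum_mul]
          congr 1
          · ring
          · exact Finset.sum_congr rfl fun j _ => by ring
  -- the `L²` energy estimate for the difference on `[0, T]`
  have hres : ∀ s ∈ Ico 0 T,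
      2 * ∫ x, ⟪a0 (V s x) (timeDerivWithin (Icc 0 T) (fun s y => U s y - U' s y) s x) +
          ∑ j, a j (V s x) (partialDeriv j ((fun s y => U s y - U' s y) s) x), U s x - U' s x⟫_ℝ ≤
        1 * (∫ x, ‖U s x - U' s x‖ ^ 2) + CR ^ 2 * δ := by
    intro s hs
    have hs' : s ∈ Icc 0 T := Ico_subset_Icc_self hs
    have hVs : IsSmooth (V s) := hV.isSmooth_slice (mem_univ s)
    have hV's : IsSmooth (V' s) := hV'.isSmooth_slice (mem_univ s)
    have hU's : IsSmooth (U' s) := hU'.isSmooth_slice (mem_univ s)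
    have hDs : IsSmooth fun y => U s y - U' s y := hD.isSmooth_slice (mem_univ s)
    have hdU' : IsSmooth (timeDeriv U' s) := (isSmoothSpaceTimeOn_timeDeriv hU').isSmooth_slice (mem_univ s)
    simp_rw [timeDerivWithin_Icc_eq_timeDeriv hD hT hs', hDeq s]
    have hcR : Continuous fun x => -((a0 (V s x) - a0 (V' s x)) (timeDeriv U' s x) +
        ∑ j, (a j (V s x) - a j (V' s x)) (partialDeriv j (U' s) x)) :=
      ((((isSmooth_comp h.smooth₀ hVs).continuous.sub (isSmooth_comp h.smooth₀ hV's).continuous).clm_apply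
        hdU'.continuous).add (continuous_finsetSum _ fun j _ =>
        (((isSmooth_comp (h.smooth j) hVs).continuous.sub (isSmooth_comp (h.smooth j) hV's).continuous).clm_apply
          (hU's.partialDeriv j).continuous))).neg
    have hcD : Continuous fun x => U s x - U' s x := hDs.continuous
    have hcV : Continuous fun x => ‖V s x - V' s x‖ ^ 2 := (hVs.continuous.sub hV's.continuous).norm.pow 2
    have hpt : ∀ x, 2 * ⟪-((a0 (V s x) - a0 (V' s x)) (timeDeriv U' s x) +
        ∑ j, (a j (V s x) - a j (V' s x)) (partialDeriv j (U' s) x)), U s x - U' s x⟫_ℝ ≤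
        CR ^ 2 * ‖V s x - V' s x‖ ^ 2 + ‖U s x - U' s x‖ ^ 2 := by
      intro x
      refine (two_inner_le_sq_add_sq _ _).trans (add_le_add ?_ le_rfl)
      rw [norm_neg, ← mul_pow]
      exact pow_le_pow_left₀ (norm_nonneg _) (hRpt s hs' x) 2
    have hi1 : Integrable (fun x => 2 * ⟪-((a0 (V s x) - a0 (V' s x)) (timeDeriv U' s x) +
        ∑ j, (a j (V s x) - a j (V' s x)) (partialDeriv j (U' s) x)), U s x - U' s x⟫_ℝ) volume :=
      (continuous_const.mul (hcR.inner hcD)).integrable_unitAddTorus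
    have hi2 : Integrable (fun x => CR ^ 2 * ‖V s x - V' s x‖ ^ 2) volume :=
      (continuous_const.mul hcV).integrable_unitAddTorus
    have hi3 : Integrable (fun x => ‖U s x - U' s x‖ ^ 2) volume := (hcD.norm.pow 2).integrable_unitAddTorus
    rw [← integral_const_mul]
    calc ∫ x, 2 * ⟪-((a0 (V s x) - a0 (V' s x)) (timeDeriv U' s x) +
          ∑ j, (a j (V s x) - a j (V' s x)) (partialDeriv j (U' s) x)), U s x - U' s x⟫_ℝ
        ≤ ∫ x, (CR ^ 2 * ‖V s x - V' s x‖ ^ 2 + ‖U s x - U' s x‖ ^ 2) :=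
          integral_mono hi1 (hi2.add hi3) hpt
      _ = CR ^ 2 * (∫ x, ‖V s x - V' s x‖ ^ 2) + ∫ x, ‖U s x - U' s x‖ ^ 2 := by
          rw [integral_add hi2 hi3, integral_const_mul]
      _ ≤ 1 * (∫ x, ‖U s x - U' s x‖ ^ 2) + CR ^ 2 * δ := by
          nlinarith [hδ s hs', sq_nonneg CR]
  have hbulk : ∀ s ∈ Ico 0 T, ∀ x (v : W),
      ⟪(timeDerivWithin (Icc 0 T) (fun s y => a0 (V s y)) s x +
        ∑ j, partialDeriv j ((fun j s y => a j (V s y)) j s) x) v, v⟫_ℝ ≤ K * ‖v‖ ^ 2 := by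
    intro s hs x v
    have hs' : s ∈ Icc 0 T := Ico_subset_Icc_self hs
    rw [timeDerivWithin_Icc_eq_timeDeriv hA₀ hT hs']
    exact hK V T hV hVE hVd s hs' x v
  have main := symmHypEnergy_le_gronwallBound (d := ι) (W := W) hT
    (A₀ := fun s y => a0 (V s y)) (A := fun j s y => a j (V s y)) (U := fun s y => U s y - U' s y)
    (hA₀.mono (subset_univ _)) (fun j => (hA j).mono (subset_univ _)) (hD.mono (subset_univ _))
    (fun t _ x v w' => h.symm₀ (V t x) v w') (fun j t _ x v w' => h.symm j (V t x) v w')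
    hc₀ hK0 zero_le_one (fun t _ x v => h.coer (V t x) v) hbulk hres t ht
  -- evaluate
  have hE0 : ∫ x, ⟪a0 (V 0 x) (U 0 x - U' 0 x), U 0 x - U' 0 x⟫_ℝ = 0 := by
    simp [h0]
  rw [hE0, sub_zero, gronwallBound_of_K_ne_0 hK'0.ne'] at main
  simp only [zero_mul, zero_add] at main
  have hVt : IsSmooth (V t) := hV.isSmooth_slice (mem_univ t)
  have hDt : IsSmooth fun y => U t y - U' t y := hD.isSmooth_slice (mem_univ t)
  have hlow : c₀ * ∫ x, ‖U t x - U' t x‖ ^ 2 ≤ ∫ x, ⟪a0 (V t x) (U t x - U' t x), U t x - U' t x⟫_ℝ :=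
    mul_integral_norm_sq_le_symmHypEnergy (isSmooth_comp h.smooth₀ hVt) hDt fun x v => h.coer (V t x) v
  have hexp1 : 0 ≤ Real.exp (K' * t) - 1 := by
    have : 1 ≤ Real.exp (K' * t) := Real.one_le_exp (mul_nonneg hK'0.le ht.1)
    linarith
  have hexp2 : Real.exp (K' * t) - 1 ≤ Real.exp (max K' (CR ^ 2 / (K' * c₀)) * t) - 1 := by
    gcongr
    · exact ht.1
    · exact le_max_left _ _
  have h1 : ∫ x, ‖U t x - U' t x‖ ^ 2 ≤ CR ^ 2 / (K' * c₀) * (Real.exp (K' * t) - 1) * δ := by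
    rw [show CR ^ 2 / (K' * c₀) * (Real.exp (K' * t) - 1) * δ =
      (CR ^ 2 * δ / K' * (Real.exp (K' * t) - 1)) / c₀ by field_simp]
    rw [le_div_iff₀ hc₀, mul_comm]
    exact hlow.trans main
  calc ∫ x, ‖U t x - U' t x‖ ^ 2 ≤ CR ^ 2 / (K' * c₀) * (Real.exp (K' * t) - 1) * δ := h1
    _ ≤ max K' (CR ^ 2 / (K' * c₀)) * (Real.exp (max K' (CR ^ 2 / (K' * c₀)) * t) - 1) * δ := by
        refine mul_le_mul_of_nonneg_right (mul_le_mul (le_max_right _ _) hexp2 hexp1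
          (le_max_of_le_left hK'0.le)) hδ0

/-- **The `L²` difference estimate** (Majda 1984, proof of Thm 2.1, (2.10)–(2.12); Dafermos
(5.1.18)–(5.1.23)): on `𝕋³`, at a level `m ≥ 3`, for bounds `E₀, D₀` there is `C ≥ 0` with the
following property. Let `U, U'` be smooth solutions of the linearised systems with smooth
coefficient fields `V, V'` and the same datum, and assume on `[0, T]` the bounds
`twordEnergy m (V t), twordEnergy m (V' t), twordEnergy m (U' t) ≤ E₀`, `‖∂ₜV‖ ≤ D₀` and
`∫‖V(t) - V'(t)‖² ≤ δ`. Then `∫‖U(t) - U'(t)‖² ≤ C (e^{Ct} - 1) δ` on `[0, T]`.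
[cite: Majda1984, Ch. 2 §2.1, Thm 2.1 (2.10)–(2.12); Dafermos2005, §5.1 (5.1.18)–(5.1.23)] -/
theorem diff_sq_integral_le (hd : Fintype.card ι = 3) (h : IsQLSymmCoeff c₀ Λ₀ a0 a p q) {m : ℕ}
    (hm : 3 ≤ m) (E₀ D₀ : ℝ) :
    ∃ C : ℝ, 0 ≤ C ∧ ∀ (V V' U U' : ℝ → UnitAddTorus ι → W) (T δ : ℝ), 0 < T →
      IsSmoothSpaceTimeOn univ V → IsSmoothSpaceTimeOn univ V' →
      IsSmoothSpaceTimeOn univ U → IsSmoothSpaceTimeOn univ U' →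
      (∀ t ∈ Icc 0 T, twordEnergy m (V t) ≤ E₀) → (∀ t ∈ Icc 0 T, twordEnergy m (V' t) ≤ E₀) →
      (∀ t ∈ Icc 0 T, twordEnergy m (U' t) ≤ E₀) →
      (∀ t ∈ Icc 0 T, ∀ x, ‖timeDeriv V t x‖ ≤ D₀) →
      (∀ t x, a0 (V t x) (timeDeriv U t x) + ∑ j, a j (V t x) (partialDeriv j (U t) x) = 0) →
      (∀ t x, a0 (V' t x) (timeDeriv U' t x) + ∑ j, a j (V' t x) (partialDeriv j (U' t) x) = 0) →
      U 0 = U' 0 → (∀ t ∈ Icc 0 T, ∫ x, ‖V t x - V' t x‖ ^ 2 ≤ δ) →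
      ∀ t ∈ Icc 0 T, ∫ x, ‖U t x - U' t x‖ ^ 2 ≤ C * (Real.exp (C * t) - 1) * δ :=
  h.diff_sq_integral_le_of_wordSup (wordSupEmbedding_two_of_card_eq_three hd) (by omega) E₀ D₀

/-! ### Propagation of higher regularity: the exponentially weighted invariant -/

/-- **The regularity-step invariant at a generic Sobolev margin `σ`** (Majda 1984, Thm 2.2,
Cor. 1, in the constructive form used inside the Picard scheme): under a word-form sup embedding
`hS : WordSupEmbedding ι σ` on `𝕋^ι`, at a level `m ≥ 2σ + 4`, for bounds `E₀, D₀` at level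
`m - 1` and a bound `Eᵢ` for the level-`m` energy of the datum there are `λ ≥ 0` and `B ≥ Eᵢ`
such that for every smooth solution `U` of `A₀(V)∂ₜU + ΣⱼAⱼ(V)∂ⱼU = 0` with
`twordEnergy (m-1) (V t), twordEnergy (m-1) (U t) ≤ E₀`, `‖∂ₜV‖ ≤ D₀` on `[0, T]` and
`twordEnergy m (U 0) ≤ Eᵢ`: if `twordEnergy m (V t) ≤ B e^{λt}` on `[0, T]` then
`twordEnergy m (U t) ≤ B e^{λt}` on `[0, T]`. The `𝕋³` case `σ = 2`, `m ≥ 8` is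
`step_invariant`. [cite: Majda1984, Ch. 2 §2.1, Thm 2.2 Cor. 1; Dafermos2005, §5.1 (5.1.16)] -/
theorem step_invariant_of_wordSup {σ : ℕ} (hS : WordSupEmbedding.{u, _} ι σ)
    (h : IsQLSymmCoeff c₀ Λ₀ a0 a p q) {m : ℕ} (hm : 2 * σ + 4 ≤ m) (E₀ D₀ Ei : ℝ) :
    ∃ lam B : ℝ, 0 ≤ lam ∧ Ei ≤ B ∧ 0 ≤ B ∧ ∀ (V U : ℝ → UnitAddTorus ι → W) (T : ℝ), 0 < T →
      IsSmoothSpaceTimeOn univ V → IsSmoothSpaceTimeOn univ U →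
      (∀ t ∈ Icc 0 T, twordEnergy (m - 1) (V t) ≤ E₀) →
      (∀ t ∈ Icc 0 T, twordEnergy (m - 1) (U t) ≤ E₀) →
      (∀ t ∈ Icc 0 T, ∀ x, ‖timeDeriv V t x‖ ≤ D₀) →
      (∀ t x, a0 (V t x) (timeDeriv U t x) + ∑ j, a j (V t x) (partialDeriv j (U t) x) = 0) →
      twordEnergy m (U 0) ≤ Ei →
      (∀ t ∈ Icc 0 T, twordEnergy m (V t) ≤ B * Real.exp (lam * t)) →
      ∀ t ∈ Icc 0 T, twordEnergy m (U t) ≤ B * Real.exp (lam * t) := by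
  obtain ⟨K, hK0, hK⟩ := h.exists_bulk_le_of_wordSup hS (by omega : σ + 1 ≤ m - 1) E₀ D₀
  choose Ct hCt0 hCt using fun j : ι =>
    exists_tcomm_sq_integral_le_step_of_wordSup hS (h.contDiff_qlATil j) hm E₀
  have hCt' : 0 ≤ ∑ j, Ct j := Finset.sum_nonneg fun j _ => hCt0 j
  have hc₀ := h.pos
  have hΛ₀ := h.Λ₀_nonneg
  set L' : ℝ := (wordsLE ι m).card * (Λ₀ ^ 2 * Fintype.card ι * ∑ j, Ct j) with hL'
  have hL'0 : 0 ≤ L' := by positivity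
  set C : ℝ := (K + (L' + 1)) / c₀ with hC
  have hC0 : 0 ≤ C := by positivity
  set B : ℝ := 2 * Λ₀ * |Ei| / c₀ + |Ei| + 1 with hB
  have hB0 : 0 < B := by positivity
  set ν : ℝ := 2 * L' * (B + 1) / (c₀ * B) + 1 with hν
  have hν0 : 0 < ν := by positivity
  have hEiB : Ei ≤ B := (le_abs_self Ei).trans (by
    rw [hB]
    have := div_nonneg (by positivity : 0 ≤ 2 * Λ₀ * |Ei|) hc₀.le
    linarith)
  refine ⟨C + ν, B, by positivity, hEiB, hB0.le, ?_⟩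
  intro V U T hT hV hU hVE hUE hVd hEq hEi hVB t ht
  set lam : ℝ := C + ν with hlam
  -- residual bound with forcing
  have hR : ∀ s ∈ Icc 0 T, ∑ w ∈ wordsLE ι m,
      ∫ x, ‖a0 (V s x) (∑ j, tcomm (qlATil a p q j) (V s) w (partialDeriv j (U s)) x)‖ ^ 2 ≤
        L' * twordEnergy m (U s) + (fun s => L' * (twordEnergy m (V s) + 1)) s := by
    intro s hs
    have hVs : IsSmooth (V s) := hV.isSmooth_slice (mem_univ s)
    have hUs : IsSmooth (U s) := hU.isSmooth_slice (mem_univ s)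
    have hw : ∀ w ∈ wordsLE ι m,
        ∫ x, ‖a0 (V s x) (∑ j, tcomm (qlATil a p q j) (V s) w (partialDeriv j (U s)) x)‖ ^ 2 ≤
          Λ₀ ^ 2 * Fintype.card ι * ∑ j, Ct j *
            (twordEnergy m (U s) + twordEnergy m (V s) + 1) := by
      intro w hw'
      refine (h.residual_sq_integral_le hVs.continuous fun j =>
        (isSmooth_tcomm (h.contDiff_qlATil j) hVs w (hUs.partialDeriv j)).continuous).trans ?_
      refine mul_le_mul_of_nonneg_left (Finset.sum_le_sum fun j _ => ?_) (by positivity)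
      exact hCt j (V s) (U s) hVs hUs (hVE s hs) (hUE s hs) w hw' j
    refine (Finset.sum_le_sum hw).trans (le_of_eq ?_)
    simp only [Finset.sum_const, nsmul_eq_mul, ← Finset.sum_mul, hL']
    ring
  have hf : ∀ s ∈ Icc 0 T, Real.exp (-(lam * s)) * (fun s => L' * (twordEnergy m (V s) + 1)) s ≤
      L' * (B + 1) := by
    intro s hs
    have he1 : Real.exp (-(lam * s)) ≤ 1 := Real.exp_le_one_iff.2 (by nlinarith [hs.1])
    have he0 : 0 < Real.exp (-(lam * s)) := Real.exp_pos _
    have hVB' : Real.exp (-(lam * s)) * twordEnergy m (V s) ≤ B := by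
      have := hVB s hs
      rw [Real.exp_neg]
      rw [inv_mul_le_iff₀ (Real.exp_pos _), mul_comm]
      exact this
    have hEV0 := twordEnergy_nonneg m (V s)
    simp only
    nlinarith [mul_le_mul_of_nonneg_left hVB' hL'0, mul_le_mul_of_nonneg_left he1 hL'0]
  have core := h.weighted_energy_le hV hU hT hEq m hK0 hL'0 (lam := lam) (ε := L' * (B + 1))
    (f := fun s => L' * (twordEnergy m (V s) + 1)) (hK V T hV hVE hVd) hR hf t ht
  have hrate : (K + (L' + 1)) / c₀ - lam = -ν := by rw [hlam, hC]; ring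
  rw [hrate] at core
  have hV0 : IsSmooth (V 0) := hV.isSmooth_slice (mem_univ 0)
  have hU0 : IsSmooth (U 0) := hU.isSmooth_slice (mem_univ 0)
  have hVt : IsSmooth (V t) := hV.isSmooth_slice (mem_univ t)
  have hUt : IsSmooth (U t) := hU.isSmooth_slice (mem_univ t)
  have hEA0 := h.a0Energy_le hV0 hU0 m
  have hEA00 : 0 ≤ ∑ w ∈ wordsLE ι m,
      ∫ x, ⟪a0 (V 0 x) (iterPartialDeriv w (U 0) x), iterPartialDeriv w (U 0) x⟫_ℝ :=
    (mul_nonneg hc₀.le (twordEnergy_nonneg m (U 0))).trans (h.mul_twordEnergy_le hV0 hU0 m)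
  have hgb := gronwallBound_le_of_neg (ε := L' * (B + 1)) (neg_neg_of_pos hν0) hEA00 (by positivity) ht.1
  rw [neg_neg] at hgb
  have hεν : L' * (B + 1) / ν ≤ c₀ * B / 2 := by
    rw [div_le_iff₀ hν0, hν]
    have e3 : 2 * L' * (B + 1) / (c₀ * B) * (c₀ * B) = 2 * L' * (B + 1) :=
      div_mul_cancel₀ _ (mul_pos hc₀ hB0).ne'
    have : c₀ * B / 2 * (2 * L' * (B + 1) / (c₀ * B) + 1) = L' * (B + 1) + c₀ * B / 2 := by
      linear_combination (1 / 2 : ℝ) * e3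
    rw [this]
    linarith [mul_pos hc₀ hB0]
  have hEi0 : 0 ≤ Ei := (twordEnergy_nonneg m (U 0)).trans hEi
  have hΛEi : Λ₀ * twordEnergy m (U 0) ≤ c₀ * B / 2 := by
    calc Λ₀ * twordEnergy m (U 0) ≤ Λ₀ * |Ei| := by
          rw [abs_of_nonneg hEi0]; exact mul_le_mul_of_nonneg_left hEi hΛ₀
      _ ≤ c₀ * B / 2 := by
          have e1 : 2 * Λ₀ * |Ei| / c₀ * c₀ = 2 * Λ₀ * |Ei| := div_mul_cancel₀ _ hc₀.ne'
          have e2 : c₀ * B = 2 * Λ₀ * |Ei| + c₀ * (|Ei| + 1) := by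
            rw [hB]
            linear_combination e1
          nlinarith [abs_nonneg Ei, e2]
  -- assemble
  have hlow := h.mul_twordEnergy_le hVt hUt m
  have hexp : 0 < Real.exp (-(lam * t)) := Real.exp_pos _
  have key : Real.exp (-(lam * t)) * (c₀ * twordEnergy m (U t)) ≤ c₀ * B := by
    calc Real.exp (-(lam * t)) * (c₀ * twordEnergy m (U t))
        ≤ Real.exp (-(lam * t)) * ∑ w ∈ wordsLE ι m,
            ∫ x, ⟪a0 (V t x) (iterPartialDeriv w (U t) x), iterPartialDeriv w (U t) x⟫_ℝ :=
          mul_le_mul_of_nonneg_left hlow hexp.le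
      _ ≤ _ := core
      _ ≤ _ := hgb
      _ ≤ Λ₀ * twordEnergy m (U 0) + c₀ * B / 2 := add_le_add hEA0 hεν
      _ ≤ c₀ * B / 2 + c₀ * B / 2 := add_le_add hΛEi le_rfl
      _ = c₀ * B := by ring
  rw [Real.exp_neg, inv_mul_le_iff₀ (Real.exp_pos _)] at key
  nlinarith [key, Real.exp_pos (lam * t)]

/-- **The regularity-step invariant** (Majda 1984, Thm 2.2, Cor. 1, in the constructive form
used inside the Picard scheme): on `𝕋³`, at a level `m ≥ 8`, for bounds `E₀, D₀` at level
`m - 1` and a bound `Eᵢ` for the level-`m` energy of the datum there are `λ ≥ 0` and `B ≥ Eᵢ`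
such that for every smooth solution `U` of `A₀(V)∂ₜU + ΣⱼAⱼ(V)∂ⱼU = 0` with
`twordEnergy (m-1) (V t), twordEnergy (m-1) (U t) ≤ E₀`, `‖∂ₜV‖ ≤ D₀` on `[0, T]` and
`twordEnergy m (U 0) ≤ Eᵢ`: if `twordEnergy m (V t) ≤ B e^{λt}` on `[0, T]` then
`twordEnergy m (U t) ≤ B e^{λt}` on `[0, T]`. (Linear level-`m` estimate with level-`(m-1)`
constants, closed by the exponential weight.)
[cite: Majda1984, Ch. 2 §2.1, Thm 2.2 Cor. 1; Dafermos2005, §5.1 (5.1.16)] -/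
theorem step_invariant (hd : Fintype.card ι = 3) (h : IsQLSymmCoeff c₀ Λ₀ a0 a p q) {m : ℕ}
    (hm : 8 ≤ m) (E₀ D₀ Ei : ℝ) :
    ∃ lam B : ℝ, 0 ≤ lam ∧ Ei ≤ B ∧ 0 ≤ B ∧ ∀ (V U : ℝ → UnitAddTorus ι → W) (T : ℝ), 0 < T →
      IsSmoothSpaceTimeOn univ V → IsSmoothSpaceTimeOn univ U →
      (∀ t ∈ Icc 0 T, twordEnergy (m - 1) (V t) ≤ E₀) →
      (∀ t ∈ Icc 0 T, twordEnergy (m - 1) (U t) ≤ E₀) →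
      (∀ t ∈ Icc 0 T, ∀ x, ‖timeDeriv V t x‖ ≤ D₀) →
      (∀ t x, a0 (V t x) (timeDeriv U t x) + ∑ j, a j (V t x) (partialDeriv j (U t) x) = 0) →
      twordEnergy m (U 0) ≤ Ei →
      (∀ t ∈ Icc 0 T, twordEnergy m (V t) ≤ B * Real.exp (lam * t)) →
      ∀ t ∈ Icc 0 T, twordEnergy m (U t) ≤ B * Real.exp (lam * t) :=
  h.step_invariant_of_wordSup (wordSupEmbedding_two_of_card_eq_three hd) (by omega) E₀ D₀ Ei

end IsQLSymmCoeff

end Coeff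

end Literature.Analysis.PDE

end
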